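/-
Copyright (c) 2026. All rights reserved.
Released under Apache 2.0 license as described in the file LICENSE.
-/
import Literature.Probability.LatticeModels.FKGEquality
import HarnessLib

/-!
# Equality in the Ahlswede–Daykin four functions theorem on the Boolean lattice (Chan–Pak 2026, Thm. 5.1)

CITATION HEADER.  Source: S. H. Chan, I. Pak, *Equality conditions for correlation inequalities*, arXiv:2607.06275
(July 2026, unrefereed preprint) [ChanPak2026], §§5–7 (pp. 15–25), read 2026-08-20 from the materialised arXiv
text (corpus `paper:arxiv-2607.06275`, p0015–p0025).  Background: the four functions theorem of Ahlswede–Daykin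
[AhlswedeDaykin1978, Theorem 1] (Mathlib: `four_functions_theorem_univ`), whose equality cases are the subject.
This file formalises the core technical theorem of [ChanPak2026] — the Boolean-lattice case, from which their
Thm. 1.3 (general finite distributive lattices), Thm. 1.6 (FKG equality; in the tree independently as
`FKGEqualityLattice.fkg_eq_iff_exists_prod`), Thm. 8.1 and Thm. 8.3 are derived in their §§8–9.

## What is printed (verbatim)

* (AD-cond) `a(x) b(y) ≤ c(x ∨ y) d(x ∧ y) ∀ x, y ∈ L`; (AD) `Σa · Σb ≤ Σc · Σd` [Thm. 1.1].
* **Theorem 5.1** (AD equality for Boolean lattices, p. 15): "Let `a, b, c, d : L_n → ℝ≥0` satisfy (AD-cond).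
  Then the AD equality holds: `Σ_{x∈L_n} a(x) · Σ b(x) = Σ c(x) · Σ d(x)` (5.1) if and only if there exist a subset
  `A ⊆ [n]`, such that `a(x₁,x₂) b(y₁,y₂) = c(x₁,y₂) d(y₁,x₂) ∀ (x₁,x₂), (y₁,y₂) ∈ {0,1}^A × {0,1}^{[n]−A}` (5.2)."
* **Lemma 5.2** (`n = 1`, p. 16): with (A0) `a(0)b(0) = c(0)d(0)` and `a(1)b(1) = c(1)d(1)`, (A1) `a(0)b(1) = c(0)d(1)`
  and `a(1)b(0) = c(1)d(0)`, (A2) `a(0)b(1) = c(1)d(0)` and `a(1)b(0) = c(0)d(1)`: "(5.1) holds if and only if (A0)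
  holds, and either (A1) or (A2) holds."
* §5.3 restriction `f(x, ∗^{n−1})`, §5.4 averaging `f(∘, ∗^{n−1})`; **Lemma 5.3** / **Lemma 5.4**: the restricted
  quadruple `a(∗,x,∗), b(∗,y,∗), c(∗,x∨y,∗), d(∗,x∧y,∗)` and the averaged quadruple satisfy (AD-cond);
  **Lemma 5.5**: (AD-cond) and (AD-eq) give `a(x) b(x) = c(x) d(x)` for all `x`.
* **Lemma 6.1** (Consistency lemma, p. 18): if (AD-cond), (AD-eq) and, for all `z ∈ {0,∘}ⁿ`,
  `a(1_k0_{n−k} + z) b(0_k1_{n−k} + z) = c(1_n + z) d(0_n + z)` (6.1), then (6.2) = (5.2) for `A = [k]`.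
* **Definition 7.1** (types): `i` has type (B1) if `a(∘,1,∘) b(∘,0,∘) = c(∘,1,∘) d(∘,0,∘)`, type (B2) if
  `a(∘,0,∘) b(∘,1,∘) = c(∘,1,∘) d(∘,0,∘)`; "each `i ∈ [n]` must have at least one of these two types".
* **Lemma 7.2** (Identification lemma, p. 21): with `x_i := 1` if `i` is of type (B1), `0` otherwise, `y := 1 + x`:
  `a(x + z) b(y + z) = c(1_n + z) d(0_n + z)` for all `z ∈ {0,∘}ⁿ` (7.2).  **Lemma 7.4** (`n = 2`, both coordinates
  of type (B1) ⇒ `a(1,1)b(0,0) = c(1,1)d(0,0)`), **Lemma 7.5** (`n = 2`, types (B1), (B2) and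
  `a(1,0)b(0,1) ≠ c(1,1)d(0,0)` ⇒ both coordinates have both types).  §7.4: Theorem 5.1 follows from 7.2 + 6.1.

## What is proved here (everything; no named facts; axioms `propext`, `Classical.choice`, `Quot.sound`)

MODELLING.  `L_n = {0,1}ⁿ` is `Set ι` for a finite type `ι` (`∨ = ∪`, `∧ = ∩`); a pattern `w ∈ {0,1}ⁿ` with
averaged positions `z ∈ {0,∘}ⁿ` is the pair `(Z, U)` (`Z` = the `∘`-positions) and `f(w + z)` is the cylinder
sum `avg Z f U := Σ_X f(mix Z X U)` (`mix` from `FKGEquality.lean`; each point of the cylinder is counted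
`2^{|ι∖Z|}` times — a uniform factor that cancels from every identity below, all of which are homogeneous).
Restriction at `i` to the bit `t` is `res i t f = f ∘ (setBit · i t)`.  The cross relation (5.2) is
`CrossEq A a b c d : ∀ X Y, a X · b Y = c (mix A X Y) · d (mix A Y X)` (`mix A X Y = (x₁, y₂)`).
* Part A (real algebra): `ad1_le` (the `n = 1` AD inequality), **`lemma52`** (Lemma 5.2; proved directly from
  `(P − u)(P − v) ≥ 0` rather than by the printed `ε`-perturbation of `c(0)` — same content), the `{0,1}²`
  context `AD2` with `row52`/`col52`/`rowTot52`/`colTot52` (Lemma 5.2 for rows, columns and their averages),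
  **`diag2`** (Lemma 5.5, `n = 2`), **`lemma74`**, **`lemma75`** (both halves; the printed half is `lemma75_snd`,
  the other by the symmetry `a ↔ b` + transposition), `lemma74'` (Lemma 7.4 for two (B2) coordinates).
* Part B (`2^ι`): `IsAD` (AD-cond with nonnegativity), `ADEq`, `avg`, `setBit`, `res`; **`avg_mul_avg_le`** —
  Lemmas 5.3 + 5.4 + the AD inequality in one statement `avg Z a U · avg Z b V ≤ avg Z c (U ∪ V) · avg Z d (U ∩ V)`
  (from Mathlib's `four_functions_theorem_univ`); `avg_insert` (averaging one more coordinate); **`collapse`**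
  (Lemma 5.2 applied to the coordinate `i` of any derived quadruple); `TypeB1`/`TypeB2` (Def. 7.1), **`hasType`**;
  **`diag_avg`**, **`diag`** (Lemma 5.5); the two-coordinate context `q2` with `ad2_ctx`, `row_q2`, `col_q2`,
  `tot_q2`; **`lemma72`** (Identification Lemma: `HypH a b c d A (↑T)ᶜ` for every finite `T`, `A = {B1-types}`);
  `IsAD.res` (Lemma 5.3), `avg_res`, `sum_res`, `detBy_res`, `avg_sdiff_singleton_of_detBy`, `Bad`,
  `hypH_res_of_not_bad` (Cases 1–2 of §6.2), `sum_cross_sub_eq_zero`; **`lemma61`** (Consistency Lemma, by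
  induction on the set of live coordinates, functions `DetBy ↑s`); **`crossEq_of_adEq`**, **`adEq_of_crossEq`**,
  **`chanPak_thm51`** (Theorem 5.1 as an `iff`).
DEVIATIONS FROM PRINT (bookkeeping only).  (i) The source inducts on the dimension `n`, passing to restricted /
averaged quadruples in dimension `n − 1`; here the ambient `2^ι` is fixed: averaged coordinates are carried by
`Z` (so the Identification Lemma is an induction on the number of non-averaged coordinates, with the SAME
recursion: `|T| ≤ 1` = the types, `|T| = 2` = Lemmas 7.4/7.5, `|T| ≥ 3` = pigeonhole + Lemma 7.4), and restricted
quadruples are functions on `2^ι` that ignore the restricted coordinate (`DetBy`, so the Consistency Lemma is an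
induction on the live set `s`, the all-bad pair being settled by the printed counting argument, here with the
multiplicity of dead coordinates).  (ii) "By permuting indices WLOG `A = [k]`" is unnecessary: `A` is a set.

## References
* S. H. Chan, I. Pak, *Equality conditions for correlation inequalities*, arXiv:2607.06275 (2026), §§5–7:
  Thm. 5.1, Lemmas 5.2–5.5, 6.1, 7.2, 7.4, 7.5, Def. 7.1. [ChanPak2026]
* R. Ahlswede, D. E. Daykin, *An inequality for the weights of two families of sets, their unions and
  intersections*, Z. Wahrsch. Verw. Gebiete 43 (1978) 183–185, Theorem 1. [AhlswedeDaykin1978]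
-/

noncomputable section

open scoped Classical

namespace Literature.Probability.LatticeModels.FourFunctionsEquality

open Finset

/-! ## Part A.  The cases `n = 1` and `n = 2` as real algebra -/

section OneDim

/-- The `n = 1` four functions inequality: for eight nonnegative reals with `a₀b₀ ≤ c₀d₀`, `a₁b₁ ≤ c₁d₁`,
`a₀b₁ ≤ c₁d₀`, `a₁b₀ ≤ c₁d₀` one has `(a₀+a₁)(b₀+b₁) ≤ (c₀+c₁)(d₀+d₁)`.
[cite: ChanPak2026, Thm. 1.1 (the case L = {0,1})] [cite: AhlswedeDaykin1978, Thm. 1] -/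
theorem ad1_le {a0 a1 b0 b1 c0 c1 d0 d1 : ℝ} (ha0 : 0 ≤ a0) (ha1 : 0 ≤ a1) (hb0 : 0 ≤ b0) (hb1 : 0 ≤ b1)
    (hc0 : 0 ≤ c0) (hc1 : 0 ≤ c1) (hd0 : 0 ≤ d0) (hd1 : 0 ≤ d1)
    (h00 : a0 * b0 ≤ c0 * d0) (h11 : a1 * b1 ≤ c1 * d1) (h01 : a0 * b1 ≤ c1 * d0) (h10 : a1 * b0 ≤ c1 * d0) :
    (a0 + a1) * (b0 + b1) ≤ (c0 + c1) * (d0 + d1) := by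
  -- `u := a₀b₁`, `v := a₁b₀`, `P := c₁d₀`, `Q := c₀d₁`: `u, v ≤ P` and `uv ≤ PQ` give `u + v ≤ P + Q`
  have huv : (a0 * b1) * (a1 * b0) ≤ (c1 * d0) * (c0 * d1) := by
    calc (a0 * b1) * (a1 * b0) = (a0 * b0) * (a1 * b1) := by ring
      _ ≤ (c0 * d0) * (c1 * d1) :=
          mul_le_mul h00 h11 (mul_nonneg ha1 hb1) (mul_nonneg hc0 hd0)
      _ = (c1 * d0) * (c0 * d1) := by ring
  have hcross : a0 * b1 + a1 * b0 ≤ c1 * d0 + c0 * d1 := by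
    by_cases hP : c1 * d0 = 0
    · have hu : a0 * b1 = 0 := le_antisymm (hP ▸ h01) (mul_nonneg ha0 hb1)
      have hv : a1 * b0 = 0 := le_antisymm (hP ▸ h10) (mul_nonneg ha1 hb0)
      rw [hu, hv, hP]
      linarith [mul_nonneg hc0 hd1]
    · have hPpos : 0 < c1 * d0 := lt_of_le_of_ne (mul_nonneg hc1 hd0) (Ne.symm hP)
      have key : (c1 * d0) * (a0 * b1 + a1 * b0) ≤ (c1 * d0) * (c1 * d0 + c0 * d1) := by
        nlinarith [mul_nonneg (sub_nonneg.2 h01) (sub_nonneg.2 h10)]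
      exact le_of_mul_le_mul_left key hPpos
  nlinarith [hcross, h00, h11]

/-- **Lemma 5.2** (the case `n = 1`) as real algebra: for eight nonnegative reals satisfying (AD-cond) on
`L = {0,1}` (`a₀b₀ ≤ c₀d₀`, `a₁b₁ ≤ c₁d₁`, `a₀b₁ ≤ c₁d₀`, `a₁b₀ ≤ c₁d₀`) and the equality
`(a₀+a₁)(b₀+b₁) = (c₀+c₁)(d₀+d₁)` (5.1), condition (A0) `a₀b₀ = c₀d₀ ∧ a₁b₁ = c₁d₁` holds, and either
(A1) `a₀b₁ = c₀d₁ ∧ a₁b₀ = c₁d₀` or (A2) `a₀b₁ = c₁d₀ ∧ a₁b₀ = c₀d₁` holds.  (Printed proof: perturb `c(0)` and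
use the AD inequality; here directly from the `n = 1` inequality and `(P−u)(P−v) ≥ 0`.)
[cite: ChanPak2026, Lemma 5.2] -/
theorem lemma52 {a0 a1 b0 b1 c0 c1 d0 d1 : ℝ} (ha0 : 0 ≤ a0) (ha1 : 0 ≤ a1) (hb0 : 0 ≤ b0) (hb1 : 0 ≤ b1)
    (hc0 : 0 ≤ c0) (hc1 : 0 ≤ c1) (hd0 : 0 ≤ d0) (hd1 : 0 ≤ d1)
    (h00 : a0 * b0 ≤ c0 * d0) (h11 : a1 * b1 ≤ c1 * d1) (h01 : a0 * b1 ≤ c1 * d0) (h10 : a1 * b0 ≤ c1 * d0)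
    (heq : (a0 + a1) * (b0 + b1) = (c0 + c1) * (d0 + d1)) :
    (a0 * b0 = c0 * d0 ∧ a1 * b1 = c1 * d1) ∧
      ((a0 * b1 = c0 * d1 ∧ a1 * b0 = c1 * d0) ∨ (a0 * b1 = c1 * d0 ∧ a1 * b0 = c0 * d1)) := by
  have huv : (a0 * b1) * (a1 * b0) ≤ (c1 * d0) * (c0 * d1) := by
    calc (a0 * b1) * (a1 * b0) = (a0 * b0) * (a1 * b1) := by ring
      _ ≤ (c0 * d0) * (c1 * d1) :=
          mul_le_mul h00 h11 (mul_nonneg ha1 hb1) (mul_nonneg hc0 hd0)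
      _ = (c1 * d0) * (c0 * d1) := by ring
  -- the cross inequality `u + v ≤ P + Q`
  have hcross : a0 * b1 + a1 * b0 ≤ c1 * d0 + c0 * d1 := by
    by_cases hP : c1 * d0 = 0
    · have hu : a0 * b1 = 0 := le_antisymm (hP ▸ h01) (mul_nonneg ha0 hb1)
      have hv : a1 * b0 = 0 := le_antisymm (hP ▸ h10) (mul_nonneg ha1 hb0)
      rw [hu, hv, hP]
      linarith [mul_nonneg hc0 hd1]
    · have hPpos : 0 < c1 * d0 := lt_of_le_of_ne (mul_nonneg hc1 hd0) (Ne.symm hP)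
      have key : (c1 * d0) * (a0 * b1 + a1 * b0) ≤ (c1 * d0) * (c1 * d0 + c0 * d1) := by
        nlinarith [mul_nonneg (sub_nonneg.2 h01) (sub_nonneg.2 h10)]
      exact le_of_mul_le_mul_left key hPpos
  -- the three inequalities sum to an equality, hence each is an equality
  have hexp : a0 * b0 + a1 * b1 + (a0 * b1 + a1 * b0) = c0 * d0 + c1 * d1 + (c1 * d0 + c0 * d1) := by
    linear_combination heq
  have hA00 : a0 * b0 = c0 * d0 := by linarith
  have hA11 : a1 * b1 = c1 * d1 := by linarith
  have hsum : a0 * b1 + a1 * b0 = c1 * d0 + c0 * d1 := by linarith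
  refine ⟨⟨hA00, hA11⟩, ?_⟩
  by_cases hP : c1 * d0 = 0
  · -- `P = 0`: then `u = v = 0` and `Q = 0`; (A1) holds
    have hu : a0 * b1 = 0 := le_antisymm (hP ▸ h01) (mul_nonneg ha0 hb1)
    have hv : a1 * b0 = 0 := le_antisymm (hP ▸ h10) (mul_nonneg ha1 hb0)
    have hQ : c0 * d1 = 0 := by linarith
    exact Or.inl ⟨by rw [hu, hQ], by rw [hv, hP]⟩
  · have hPpos : 0 < c1 * d0 := lt_of_le_of_ne (mul_nonneg hc1 hd0) (Ne.symm hP)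
    -- `uv = PQ` and `(P − u)(P − v) = 0`
    have hprod0 : (c1 * d0 - a0 * b1) * (c1 * d0 - a1 * b0) = 0 := by
      have h1 : 0 ≤ (c1 * d0 - a0 * b1) * (c1 * d0 - a1 * b0) :=
        mul_nonneg (sub_nonneg.2 h01) (sub_nonneg.2 h10)
      have h2 : (c1 * d0 - a0 * b1) * (c1 * d0 - a1 * b0) =
          (c1 * d0) * (c1 * d0) - (c1 * d0) * (a0 * b1 + a1 * b0) + (a0 * b1) * (a1 * b0) := by ring
      nlinarith [h1, h2, huv, hsum]
    rcases mul_eq_zero.1 hprod0 with h | h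
    · -- `u = P`, hence `v = Q`: (A2)
      have hu : a0 * b1 = c1 * d0 := by linarith
      exact Or.inr ⟨hu, by linarith⟩
    · -- `v = P`, hence `u = Q`: (A1)
      have hv : a1 * b0 = c1 * d0 := by linarith
      exact Or.inl ⟨by linarith, hv⟩

end OneDim

/-! ### The case `n = 2` (Definition 7.1, Lemmas 5.5, 7.4, 7.5 on `{0,1}²`, as real algebra)

Four functions `qa qb qc qd : {0,1}² → ℝ≥0`; `x || x'` is the join and `x && x'` the meet in one coordinate. -/

section TwoDim

variable {qa qb qc qd : Bool → Bool → ℝ}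

/-- (AD-cond) for four nonnegative functions on `{0,1}²`. [cite: ChanPak2026, §5.1 (AD-cond) for n = 2] -/
structure AD2 (qa qb qc qd : Bool → Bool → ℝ) : Prop where
  ha : ∀ x y, 0 ≤ qa x y
  hb : ∀ x y, 0 ≤ qb x y
  hc : ∀ x y, 0 ≤ qc x y
  hd : ∀ x y, 0 ≤ qd x y
  cond : ∀ x y x' y', qa x y * qb x' y' ≤ qc (x || x') (y || y') * qd (x && x') (y && y')

/-- Row sums `f(x, ∘) = f(x,0) + f(x,1)` (averaging the second coordinate). [cite: ChanPak2026, §5.4] -/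
def row (q : Bool → Bool → ℝ) (x : Bool) : ℝ := q x false + q x true

/-- Column sums `f(∘, y) = f(0,y) + f(1,y)` (averaging the first coordinate). [cite: ChanPak2026, §5.4] -/
def col (q : Bool → Bool → ℝ) (y : Bool) : ℝ := q false y + q true y

/-- The total sum `f(∘, ∘)`. [cite: ChanPak2026, §5.4] -/
def tot (q : Bool → Bool → ℝ) : ℝ := row q false + row q true

omit qa qb qc qd in
/-- `f(∘,∘)` via columns. [cite: ChanPak2026, §5.4] -/
theorem tot_eq_col (q : Bool → Bool → ℝ) : tot q = col q false + col q true := by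
  simp only [tot, row, col]; ring

/-- (AD-eq) on `{0,1}²`. [cite: ChanPak2026, §5.1 (5.1) for n = 2] -/
def Eq2 (qa qb qc qd : Bool → Bool → ℝ) : Prop := tot qa * tot qb = tot qc * tot qd

/-- "`i = 1` has type (B1)": `a(1,∘) b(0,∘) = c(1,∘) d(0,∘)`. [cite: ChanPak2026, Definition 7.1 (B1)] -/
def B1fst (qa qb qc qd : Bool → Bool → ℝ) : Prop := row qa true * row qb false = row qc true * row qd false

/-- "`i = 1` has type (B2)": `a(0,∘) b(1,∘) = c(1,∘) d(0,∘)`. [cite: ChanPak2026, Definition 7.1 (B2)] -/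
def B2fst (qa qb qc qd : Bool → Bool → ℝ) : Prop := row qa false * row qb true = row qc true * row qd false

/-- "`j = 2` has type (B1)": `a(∘,1) b(∘,0) = c(∘,1) d(∘,0)`. [cite: ChanPak2026, Definition 7.1 (B1)] -/
def B1snd (qa qb qc qd : Bool → Bool → ℝ) : Prop := col qa true * col qb false = col qc true * col qd false

/-- "`j = 2` has type (B2)": `a(∘,0) b(∘,1) = c(∘,1) d(∘,0)`. [cite: ChanPak2026, Definition 7.1 (B2)] -/
def B2snd (qa qb qc qd : Bool → Bool → ℝ) : Prop := col qa false * col qb true = col qc true * col qd false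

/-- (AD-cond) is symmetric under `a ↔ b`. [cite: ChanPak2026, §5.1] -/
theorem AD2.swap (h : AD2 qa qb qc qd) : AD2 qb qa qc qd where
  ha := h.hb
  hb := h.ha
  hc := h.hc
  hd := h.hd
  cond x y x' y' := by
    have := h.cond x' y' x y
    rw [Bool.or_comm x' x, Bool.or_comm y' y, Bool.and_comm x' x, Bool.and_comm y' y] at this
    linarith

/-- (AD-cond) is symmetric under swapping the two coordinates. [cite: ChanPak2026, §5.1] -/
theorem AD2.transpose (h : AD2 qa qb qc qd) :
    AD2 (fun x y => qa y x) (fun x y => qb y x) (fun x y => qc y x) (fun x y => qd y x) where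
  ha x y := h.ha y x
  hb x y := h.hb y x
  hc x y := h.hc y x
  hd x y := h.hd y x
  cond x y x' y' := h.cond y x y' x'

/-- **Lemma 5.2 for the row quadruple** `a(s,·), b(s′,·), c(s ∨ s′,·), d(s ∧ s′,·)` (these satisfy (AD-cond) by
Lemma 5.3): if `a(s,∘) b(s′,∘) = c(s∨s′,∘) d(s∧s′,∘)` then (A0) and ((A1) or (A2)) hold in the second
coordinate. [cite: ChanPak2026, Lemma 5.2 with Lemma 5.3] -/
theorem row52 (h : AD2 qa qb qc qd) (s s' : Bool)
    (heq : row qa s * row qb s' = row qc (s || s') * row qd (s && s')) :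
    (qa s false * qb s' false = qc (s || s') false * qd (s && s') false ∧
      qa s true * qb s' true = qc (s || s') true * qd (s && s') true) ∧
    ((qa s false * qb s' true = qc (s || s') false * qd (s && s') true ∧
        qa s true * qb s' false = qc (s || s') true * qd (s && s') false) ∨
      (qa s false * qb s' true = qc (s || s') true * qd (s && s') false ∧
        qa s true * qb s' false = qc (s || s') false * qd (s && s') true)) :=
  lemma52 (h.ha _ _) (h.ha _ _) (h.hb _ _) (h.hb _ _) (h.hc _ _) (h.hc _ _) (h.hd _ _) (h.hd _ _)
    (h.cond s false s' false) (h.cond s true s' true) (h.cond s false s' true) (h.cond s true s' false) heq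

/-- **Lemma 5.2 for the column quadruple** `a(·,t), b(·,t′), c(·,t ∨ t′), d(·,t ∧ t′)`.
[cite: ChanPak2026, Lemma 5.2 with Lemma 5.3] -/
theorem col52 (h : AD2 qa qb qc qd) (t t' : Bool)
    (heq : col qa t * col qb t' = col qc (t || t') * col qd (t && t')) :
    (qa false t * qb false t' = qc false (t || t') * qd false (t && t') ∧
      qa true t * qb true t' = qc true (t || t') * qd true (t && t')) ∧
    ((qa false t * qb true t' = qc false (t || t') * qd true (t && t') ∧
        qa true t * qb false t' = qc true (t || t') * qd false (t && t')) ∨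
      (qa false t * qb true t' = qc true (t || t') * qd false (t && t') ∧
        qa true t * qb false t' = qc false (t || t') * qd true (t && t'))) :=
  row52 h.transpose t t' heq

/-- The row-averaged quadruple `a(·,∘), b(·,∘), c(·,∘), d(·,∘)` satisfies (AD-cond) (Lemma 5.4, `n = 2`).
[cite: ChanPak2026, Lemma 5.4] -/
theorem row_cond (h : AD2 qa qb qc qd) (x x' : Bool) :
    row qa x * row qb x' ≤ row qc (x || x') * row qd (x && x') :=
  ad1_le (h.ha _ _) (h.ha _ _) (h.hb _ _) (h.hb _ _) (h.hc _ _) (h.hc _ _) (h.hd _ _) (h.hd _ _)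
    (h.cond x false x' false) (h.cond x true x' true) (h.cond x false x' true) (h.cond x true x' false)

/-- **Lemma 5.2 for the row-averaged quadruple**: under (AD-eq), `a(x,∘)b(x,∘) = c(x,∘)d(x,∘)` for both `x`
(A0), and `i = 1` has type (B1) or type (B2). [cite: ChanPak2026, Lemma 5.2 with Lemma 5.4; Def. 7.1] -/
theorem rowTot52 (h : AD2 qa qb qc qd) (heq : Eq2 qa qb qc qd) :
    (row qa false * row qb false = row qc false * row qd false ∧
      row qa true * row qb true = row qc true * row qd true) ∧
    (B1fst qa qb qc qd ∨ B2fst qa qb qc qd) := by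
  have hn : ∀ (q : Bool → Bool → ℝ), (∀ x y, 0 ≤ q x y) → ∀ x, 0 ≤ row q x :=
    fun q hq x => add_nonneg (hq x false) (hq x true)
  have h52 := lemma52 (hn qa h.ha false) (hn qa h.ha true) (hn qb h.hb false) (hn qb h.hb true)
    (hn qc h.hc false) (hn qc h.hc true) (hn qd h.hd false) (hn qd h.hd true)
    (row_cond h false false) (row_cond h true true) (row_cond h false true) (row_cond h true false) heq
  refine ⟨h52.1, ?_⟩
  rcases h52.2 with hA1 | hA2
  · exact Or.inl hA1.2
  · exact Or.inr hA2.1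

/-- The column version: `a(∘,y)b(∘,y) = c(∘,y)d(∘,y)` and `j = 2` has type (B1) or (B2).
[cite: ChanPak2026, Lemma 5.2 with Lemma 5.4; Def. 7.1] -/
theorem colTot52 (h : AD2 qa qb qc qd) (heq : Eq2 qa qb qc qd) :
    (col qa false * col qb false = col qc false * col qd false ∧
      col qa true * col qb true = col qc true * col qd true) ∧
    (B1snd qa qb qc qd ∨ B2snd qa qb qc qd) := by
  have heq' : Eq2 (fun x y => qa y x) (fun x y => qb y x) (fun x y => qc y x) (fun x y => qd y x) := by
    unfold Eq2 tot row at heq ⊢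
    linear_combination heq
  exact rowTot52 h.transpose heq'

/-- **Lemma 5.5** (`n = 2`): under (AD-cond) and (AD-eq), `a(x)b(x) = c(x)d(x)` for every `x ∈ {0,1}²`.
[cite: ChanPak2026, Lemma 5.5] -/
theorem diag2 (h : AD2 qa qb qc qd) (heq : Eq2 qa qb qc qd) (x y : Bool) :
    qa x y * qb x y = qc x y * qd x y := by
  have hrow : row qa x * row qb x = row qc x * row qd x := by
    cases x
    · exact (rowTot52 h heq).1.1
    · exact (rowTot52 h heq).1.2
  have h52 := row52 h x x (by simpa only [Bool.or_self, Bool.and_self] using hrow)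
  cases y
  · simpa only [Bool.or_self, Bool.and_self] using h52.1.1
  · simpa only [Bool.or_self, Bool.and_self] using h52.1.2

/-- Nonnegative reals with equal squares are equal. [folklore] -/
private theorem eq_of_mul_self_eq {u v : ℝ} (hu : 0 ≤ u) (hv : 0 ≤ v) (h : u * u = v * v) : u = v := by
  have h' : (u - v) * (u + v) = 0 := by linear_combination h
  rcases mul_eq_zero.1 h' with h1 | h1
  · linarith
  · have : u = 0 := by linarith
    have : v = 0 := by linarith
    linarith

/-- A product of two nonnegative reals is positive only if both are. [folklore] -/
private theorem pos_pos_of_mul_pos {u v : ℝ} (h : 0 < u * v) (hu : 0 ≤ u) (_hv : 0 ≤ v) : 0 < u ∧ 0 < v := by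
  rcases pos_and_pos_or_neg_and_neg_of_mul_pos h with h' | h'
  · exact h'
  · exact absurd h'.1 (not_lt.2 hu)

/-- **Lemma 7.4**: on `{0,1}²`, if (AD-cond), (AD-eq) hold and both coordinates have type (B1), then
`a(1,1) b(0,0) = c(1,1) d(0,0)`. [cite: ChanPak2026, Lemma 7.4] -/
theorem lemma74 (h : AD2 qa qb qc qd) (heq : Eq2 qa qb qc qd) (h1 : B1fst qa qb qc qd)
    (h2 : B1snd qa qb qc qd) : qa true true * qb false false = qc true true * qd false false := by
  -- Lemma 5.2 for `a(1,·), b(0,·), c(1,·), d(0,·)`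
  have hr := row52 h true false h1
  rcases hr.2 with hA1 | hA2
  · exact hA1.2
  -- case (A2): (7.4), (7.5)
  have h74 : qa true false * qb false true = qc true true * qd false false := hA2.1
  have h75 : qa true true * qb false false = qc true false * qd false true := hA2.2
  have hc := col52 h true false h2
  rcases hc.2 with hB1 | hB2
  · exact hB1.2
  -- case (A2) again: (7.6), (7.7)
  have h76 : qa false true * qb true false = qc true true * qd false false := hB2.1
  have h77 : qa true true * qb false false = qc false true * qd true false := hB2.2
  -- Lemma 5.5 at (1,0) and (0,1)
  have hd10 := diag2 h heq true false
  have hd01 := diag2 h heq false true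
  have hsq : (qa true true * qb false false) * (qa true true * qb false false) =
      (qc true true * qd false false) * (qc true true * qd false false) := by
    calc (qa true true * qb false false) * (qa true true * qb false false)
        = (qc true false * qd false true) * (qc false true * qd true false) := by rw [← h75, ← h77]
      _ = (qa true false * qb true false) * (qa false true * qb false true) := by rw [hd10, hd01]; ring
      _ = (qa true false * qb false true) * (qa false true * qb true false) := by ring
      _ = (qc true true * qd false false) * (qc true true * qd false false) := by rw [h74, h76]
  exact eq_of_mul_self_eq (mul_nonneg (h.ha _ _) (h.hb _ _)) (mul_nonneg (h.hc _ _) (h.hd _ _)) hsq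

/-- **Lemma 7.5** (the half that is proved in print): on `{0,1}²`, if (AD-cond), (AD-eq) hold, `i = 1` has type
(B1), `j = 2` has type (B2) and `a(1,0) b(0,1) ≠ c(1,1) d(0,0)` (7.8), then `j = 2` also has type (B1).
[cite: ChanPak2026, Lemma 7.5] -/
theorem lemma75_snd (h : AD2 qa qb qc qd) (heq : Eq2 qa qb qc qd) (h1 : B1fst qa qb qc qd)
    (h2 : B2snd qa qb qc qd) (h78 : qa true false * qb false true ≠ qc true true * qd false false) :
    B1snd qa qb qc qd := by
  -- Step 1: `a(1,·), b(0,·), c(1,·), d(0,·)` is in case (A1): (7.9)–(7.12)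
  have hr := row52 h true false h1
  have h79 : qa true false * qb false false = qc true false * qd false false := hr.1.1
  have h712 : qa true true * qb false true = qc true true * qd false true := hr.1.2
  have hA1 : qa true false * qb false true = qc true false * qd false true ∧
      qa true true * qb false false = qc true true * qd false false := by
    rcases hr.2 with hA1 | hA2
    · exact hA1
    · exact absurd hA2.1 h78
  have h710 := hA1.1
  have h711 := hA1.2
  -- Step 2: `a(·,0), b(·,1), c(·,1), d(·,0)`: (7.13)–(7.16)
  have hc := col52 h false true h2
  have h713 : qa false false * qb false true = qc false true * qd false false := hc.1.1
  have h716 : qa true false * qb true true = qc true true * qd true false := hc.1.2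
  have hA2 : qa false false * qb true true = qc true true * qd false false ∧
      qa true false * qb false true = qc false true * qd true false := by
    rcases hc.2 with hB1 | hB2
    · exact absurd hB1.2 h78
    · exact hB2
  have h714 := hA2.1
  have h715 := hA2.2
  -- Step 3: the column `a(·,1), b(·,1), c(·,1), d(·,1)`: (7.17)
  have hcol1 : col qa true * col qb true = col qc true * col qd true := (colTot52 h heq).1.2
  have hc1 := col52 h true true (by simpa only [Bool.or_self, Bool.and_self] using hcol1)
  have h717 : qa false true * qb true true = qc false true * qd true true := by
    rcases hc1.2 with hB1 | hB2
    · simpa only [Bool.or_self, Bool.and_self] using hB1.1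
    · have e1 : qa false true * qb true true = qc true true * qd false true := by
        simpa only [Bool.or_self, Bool.and_self] using hB2.1
      have e2 : qa true true * qb false true = qc false true * qd true true := by
        simpa only [Bool.or_self, Bool.and_self] using hB2.2
      rw [e1, ← h712, e2]
  -- Step 4: the column `a(·,0), b(·,0), c(·,0), d(·,0)`: (7.19)
  have hcol0 : col qa false * col qb false = col qc false * col qd false := (colTot52 h heq).1.1
  have hc0 := col52 h false false (by simpa only [Bool.or_self, Bool.and_self] using hcol0)
  have h719 : qa false false * qb true false = qc false false * qd true false := by
    rcases hc0.2 with hB1 | hB2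
    · simpa only [Bool.or_self, Bool.and_self] using hB1.1
    · have e1 : qa false false * qb true false = qc true false * qd false false := by
        simpa only [Bool.or_self, Bool.and_self] using hB2.1
      have e2 : qa true false * qb false false = qc false false * qd true false := by
        simpa only [Bool.or_self, Bool.and_self] using hB2.2
      rw [e1, ← h79, e2]
  -- Step 5: positivity (7.20)
  have hcd : 0 < qc true true * qd false false := by
    refine lt_of_le_of_ne (mul_nonneg (h.hc _ _) (h.hd _ _)) fun h0 => h78 ?_
    have hle := h.cond true false false true
    simp only [Bool.or_false, Bool.and_true] at hle
    exact le_antisymm (h0 ▸ hle) (h0.symm ▸ mul_nonneg (h.ha _ _) (h.hb _ _))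
  have hc11 : 0 < qc true true := (pos_pos_of_mul_pos hcd (h.hc _ _) (h.hd _ _)).1
  have hd00 : 0 < qd false false := (pos_pos_of_mul_pos hcd (h.hc _ _) (h.hd _ _)).2
  have hab1 : 0 < qa true true * qb false false := by rw [h711]; exact hcd
  have hab2 : 0 < qa false false * qb true true := by rw [h714]; exact hcd
  have ha11 : 0 < qa true true := (pos_pos_of_mul_pos hab1 (h.ha _ _) (h.hb _ _)).1
  have hb00 : 0 < qb false false := (pos_pos_of_mul_pos hab1 (h.ha _ _) (h.hb _ _)).2
  have ha00 : 0 < qa false false := (pos_pos_of_mul_pos hab2 (h.ha _ _) (h.hb _ _)).1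
  have hb11 : 0 < qb true true := (pos_pos_of_mul_pos hab2 (h.ha _ _) (h.hb _ _)).2
  have hd00' := diag2 h heq false false
  have hd11' := diag2 h heq true true
  have hcd00 : 0 < qc false false * qd false false := by rw [← hd00']; exact mul_pos ha00 hb00
  have hcd11 : 0 < qc true true * qd true true := by rw [← hd11']; exact mul_pos ha11 hb11
  have hc00 : 0 < qc false false := (pos_pos_of_mul_pos hcd00 (h.hc _ _) (h.hd _ _)).1
  have hd11 : 0 < qd true true := (pos_pos_of_mul_pos hcd11 (h.hc _ _) (h.hd _ _)).2
  -- Step 6: (7.21) and (7.22) by cancellation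
  have h721 : qa false true * qb false false = qc false true * qd false false := by
    have e : (qa false true * qb false false) * (qa true true * qb true true) =
        (qc false true * qd false false) * (qc true true * qd true true) := by
      calc (qa false true * qb false false) * (qa true true * qb true true)
          = (qa true true * qb false false) * (qa false true * qb true true) := by ring
        _ = (qc true true * qd false false) * (qc false true * qd true true) := by rw [h711, h717]
        _ = (qc false true * qd false false) * (qc true true * qd true true) := by ring
    rw [hd11'] at e
    exact mul_right_cancel₀ hcd11.ne' e
  have h722 : qa true true * qb true false = qc true true * qd true false := by
    have e : (qa true true * qb true false) * (qa false false * qb false false) =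
        (qc true true * qd true false) * (qc false false * qd false false) := by
      calc (qa true true * qb true false) * (qa false false * qb false false)
          = (qa true true * qb false false) * (qa false false * qb true false) := by ring
        _ = (qc true true * qd false false) * (qc false false * qd true false) := by rw [h711, h719]
        _ = (qc true true * qd true false) * (qc false false * qd false false) := by ring
    rw [hd00'] at e
    exact mul_right_cancel₀ hcd00.ne' e
  -- Step 7: (7.23), in three subcases
  have h723 : qa false true * qb true false = qc false true * qd true false := by
    by_cases hpos : 0 < qa true false * qb false true
    · have hd10 := diag2 h heq true false
      have hd01 := diag2 h heq false true
      have e : (qa false true * qb true false) * (qa true false * qb false true) =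
          (qc false true * qd true false) * (qa true false * qb false true) := by
        calc (qa false true * qb true false) * (qa true false * qb false true)
            = (qa false true * qb false true) * (qa true false * qb true false) := by ring
          _ = (qc false true * qd false true) * (qc true false * qd true false) := by rw [hd01, hd10]
          _ = (qc false true * qd true false) * (qc true false * qd false true) := by ring
          _ = (qc false true * qd true false) * (qa true false * qb false true) := by rw [h710]
      exact mul_right_cancel₀ hpos.ne' e
    · -- then `a(1,0) = 0` or `b(0,1) = 0`
      have hzero : qa true false = 0 ∨ qb false true = 0 := by
        by_contra hne
        push Not at hne
        exact hpos (mul_pos (lt_of_le_of_ne (h.ha _ _) (Ne.symm hne.1))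
          (lt_of_le_of_ne (h.hb _ _) (Ne.symm hne.2)))
      rcases hzero with ha10 | hb01
      · -- second subcase
        have hd10 : qd true false = 0 := by
          have e := h716; rw [ha10, zero_mul] at e
          exact (mul_eq_zero.1 e.symm).resolve_left hc11.ne'
        have hc10 : qc true false = 0 := by
          have e := h79; rw [ha10, zero_mul] at e
          exact (mul_eq_zero.1 e.symm).resolve_right hd00.ne'
        have hb10 : qb true false = 0 := by
          have e := h722; rw [hd10, mul_zero] at e
          exact (mul_eq_zero.1 e).resolve_left ha11.ne'
        rw [hb10, hd10, mul_zero, mul_zero]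
      · -- third subcase
        have hd01 : qd false true = 0 := by
          have e := h712; rw [hb01, mul_zero] at e
          exact (mul_eq_zero.1 e.symm).resolve_left hc11.ne'
        have hc01 : qc false true = 0 := by
          have e := h713; rw [hb01, mul_zero] at e
          exact (mul_eq_zero.1 e.symm).resolve_right hd00.ne'
        have ha01 : qa false true = 0 := by
          have e := h721; rw [hc01, zero_mul] at e
          exact (mul_eq_zero.1 e).resolve_right hb00.ne'
        rw [ha01, hc01, zero_mul, zero_mul]
  -- conclusion: `a(∘,1) b(∘,0) = c(∘,1) d(∘,0)` from (7.11), (7.21), (7.22), (7.23)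
  unfold B1snd col
  linear_combination h721 + h723 + h711 + h722

/-- **Lemma 7.5**: on `{0,1}²`, if (AD-cond), (AD-eq) hold, `i = 1` has type (B1), `j = 2` has type (B2) and
`a(1,0) b(0,1) ≠ c(1,1) d(0,0)`, then `i = 1` also has type (B2) and `j = 2` also has type (B1) (the other
half by the symmetry `a ↔ b`, coordinates swapped). [cite: ChanPak2026, Lemma 7.5] -/
theorem lemma75 (h : AD2 qa qb qc qd) (heq : Eq2 qa qb qc qd) (h1 : B1fst qa qb qc qd)
    (h2 : B2snd qa qb qc qd) (h78 : qa true false * qb false true ≠ qc true true * qd false false) :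
    B2fst qa qb qc qd ∧ B1snd qa qb qc qd := by
  refine ⟨?_, lemma75_snd h heq h1 h2 h78⟩
  -- apply the proved half to `(bᵀ, aᵀ, cᵀ, dᵀ)`
  have h' : AD2 (fun x y => qb y x) (fun x y => qa y x) (fun x y => qc y x) (fun x y => qd y x) :=
    h.transpose.swap
  have heq' : Eq2 (fun x y => qb y x) (fun x y => qa y x) (fun x y => qc y x) (fun x y => qd y x) := by
    unfold Eq2 at heq ⊢
    rw [tot_eq_col, tot_eq_col, tot_eq_col, tot_eq_col]
    simpa only [tot, row, col, mul_comm] using heq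
  have h1' : B1fst (fun x y => qb y x) (fun x y => qa y x) (fun x y => qc y x) (fun x y => qd y x) := by
    unfold B1fst row; unfold B2snd col at h2; linarith [h2]
  have h2' : B2snd (fun x y => qb y x) (fun x y => qa y x) (fun x y => qc y x) (fun x y => qd y x) := by
    unfold B2snd col; unfold B1fst row at h1; linarith [h1]
  have h78' : (fun x y => qb y x) true false * (fun x y => qa y x) false true ≠
      (fun x y => qc y x) true true * (fun x y => qd y x) false false := by
    simpa only [mul_comm] using h78
  have := lemma75_snd h' heq' h1' h2' h78'
  unfold B1snd col at this; unfold B2fst row; linarith [this]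

/-- **Lemma 7.4 for two coordinates of type (B2)** (the symmetry `a ↔ b`): `a(0,0) b(1,1) = c(1,1) d(0,0)`.
[cite: ChanPak2026, Lemma 7.4] -/
theorem lemma74' (h : AD2 qa qb qc qd) (heq : Eq2 qa qb qc qd) (h1 : B2fst qa qb qc qd)
    (h2 : B2snd qa qb qc qd) : qa false false * qb true true = qc true true * qd false false := by
  have heq' : Eq2 qb qa qc qd := by unfold Eq2 at heq ⊢; rw [mul_comm]; exact heq
  have h1' : B1fst qb qa qc qd := by unfold B1fst; unfold B2fst at h1; rw [mul_comm]; exact h1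
  have h2' : B1snd qb qa qc qd := by unfold B1snd; unfold B2snd at h2; rw [mul_comm]; exact h2
  have := lemma74 h.swap heq' h1' h2'
  rw [mul_comm] at this
  exact this

end TwoDim

/-! ## Part B.  The Boolean lattice `2^ι`

Configurations are subsets `X : Set ι` of a finite type `ι` (`⊔ = ∪`, `⊓ = ∩`).  `mix S ω β = ω ∩ S ∪ β ∖ S` (from
`FKGEquality.lean`) is the configuration agreeing with `ω` on `S` and with `β` off `S`. -/

section Boolean

open FKGEquality (mix mixEquiv DetBy)

variable {ι : Type*} [Fintype ι]

/-! ### Set algebra of `mix` and `setBit` -/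

omit [Fintype ι] in
/-- Membership in `mix`. [folklore] -/
private theorem mem_mix {S ω β : Set ι} {e : ι} : e ∈ mix S ω β ↔ (e ∈ ω ∧ e ∈ S) ∨ (e ∈ β ∧ e ∉ S) := by
  simp only [mix, Set.mem_union, Set.mem_inter_iff, Set.mem_sdiff]

omit [Fintype ι] in
/-- `mix` commutes with unions in both arguments simultaneously. [folklore] -/
private theorem mix_union_mix (Z X Y U V : Set ι) : mix Z X U ∪ mix Z Y V = mix Z (X ∪ Y) (U ∪ V) := by
  ext e; simp only [Set.mem_union, mem_mix]; tauto

omit [Fintype ι] in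
/-- `mix` commutes with intersections in both arguments simultaneously. [folklore] -/
private theorem mix_inter_mix (Z X Y U V : Set ι) : mix Z X U ∩ mix Z Y V = mix Z (X ∩ Y) (U ∩ V) := by
  ext e; simp only [Set.mem_inter_iff, mem_mix]; tauto

omit [Fintype ι] in
/-- Averaging every coordinate: `mix univ X U = X`. [folklore] -/
private theorem mix_univ (X U : Set ι) : mix Set.univ X U = X := by
  ext e; simp only [mem_mix, Set.mem_univ, and_true, not_true, and_false, or_false]

omit [Fintype ι] in
/-- Averaging no coordinate: `mix ∅ X U = U`. [folklore] -/
private theorem mix_empty (X U : Set ι) : mix ∅ X U = U := by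
  ext e; simp only [mem_mix, Set.mem_empty_iff_false, and_false, not_false_eq_true, and_true, false_or]

omit [Fintype ι] in
/-- `mix Z X U` depends on `U` only off `Z`. [folklore] -/
private theorem mix_congr {Z U U' : Set ι} (h : ∀ e, e ∉ Z → (e ∈ U ↔ e ∈ U')) (X : Set ι) :
    mix Z X U = mix Z X U' := by
  ext e
  simp only [mem_mix]
  by_cases he : e ∈ Z
  · simp only [he, and_true, not_true, and_false]
  · simp only [he, and_false, not_false_eq_true, and_true, false_or, h e he]

/-- `setBit U i t`: the configuration `U` with the bit at `i` set to `t` (the restriction operation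
`f(∗^{i−1}, x, ∗^{n−i})` of the source acts on patterns this way). [cite: ChanPak2026, §5.3 (restriction operation)] -/
def setBit (U : Set ι) (i : ι) (t : Bool) : Set ι := bif t then insert i U else U \ {i}

omit [Fintype ι] in
/-- `setBit U i 1 = U ∪ {i}`. [cite: ChanPak2026, §5.3] -/
@[simp] theorem setBit_true (U : Set ι) (i : ι) : setBit U i true = insert i U := rfl

omit [Fintype ι] in
/-- `setBit U i 0 = U ∖ {i}`. [cite: ChanPak2026, §5.3] -/
@[simp] theorem setBit_false (U : Set ι) (i : ι) : setBit U i false = U \ {i} := rfl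

omit [Fintype ι] in
/-- Membership in `setBit`. [folklore] -/
private theorem mem_setBit {U : Set ι} {i e : ι} {t : Bool} :
    e ∈ setBit U i t ↔ (e = i ∧ t = true) ∨ (e ∈ U ∧ e ≠ i) := by
  cases t
  · simp only [setBit_false, Set.mem_sdiff, Set.mem_singleton_iff, Bool.false_eq_true, and_false, false_or]
  · simp only [setBit_true, Set.mem_insert_iff, and_true]
    tauto

omit [Fintype ι] in
/-- Joins of patterns: `setBit U i x ∪ setBit V i y = setBit (U ∪ V) i (x ∨ y)`. [folklore] -/
private theorem setBit_union (U V : Set ι) (i : ι) (x y : Bool) :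
    setBit U i x ∪ setBit V i y = setBit (U ∪ V) i (x || y) := by
  ext e
  simp only [Set.mem_union, mem_setBit, Bool.or_eq_true]
  tauto

omit [Fintype ι] in
/-- Meets of patterns: `setBit U i x ∩ setBit V i y = setBit (U ∩ V) i (x ∧ y)`. [folklore] -/
private theorem setBit_inter (U V : Set ι) (i : ι) (x y : Bool) :
    setBit U i x ∩ setBit V i y = setBit (U ∩ V) i (x && y) := by
  ext e
  simp only [Set.mem_inter_iff, mem_setBit, Bool.and_eq_true]
  constructor
  · rintro ⟨h1 | h1, h2 | h2⟩
    · exact Or.inl ⟨h1.1, h1.2, h2.2⟩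
    · exact absurd h1.1 h2.2
    · exact absurd h2.1 h1.2
    · exact Or.inr ⟨⟨h1.1, h2.1⟩, h1.2⟩
  · rintro (h | h)
    · exact ⟨Or.inl ⟨h.1, h.2.1⟩, Or.inl ⟨h.1, h.2.2⟩⟩
    · exact ⟨Or.inr ⟨h.1.1, h.2⟩, Or.inr ⟨h.1.2, h.2⟩⟩

omit [Fintype ι] in
/-- Setting a bit to its current value. [folklore] -/
private theorem setBit_of_mem {U : Set ι} {i : ι} (h : i ∈ U) : setBit U i true = U := by
  rw [setBit_true, Set.insert_eq_of_mem h]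

omit [Fintype ι] in
/-- Setting a bit to its current value. [folklore] -/
private theorem setBit_of_not_mem {U : Set ι} {i : ι} (h : i ∉ U) : setBit U i false = U := by
  rw [setBit_false, Set.sdiff_singleton_eq_self h]

omit [Fintype ι] in
/-- Setting two different bits commutes. [folklore] -/
private theorem setBit_comm {i j : ι} (hij : i ≠ j) (U : Set ι) (x y : Bool) :
    setBit (setBit U i x) j y = setBit (setBit U j y) i x := by
  ext e
  simp only [mem_setBit]
  by_cases hei : e = i
  · have hej : e ≠ j := fun h => hij (hei.symm.trans h)
    tauto
  · by_cases hej : e = j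
    · tauto
    · tauto

omit [Fintype ι] in
/-- Off `Z`, `mix Z X (setBit U i t)` is `setBit (mix Z X U) i t` (for `i ∉ Z`). [folklore] -/
private theorem mix_setBit {Z : Set ι} {i : ι} (hi : i ∉ Z) (X U : Set ι) (t : Bool) :
    mix Z X (setBit U i t) = setBit (mix Z X U) i t := by
  ext e
  simp only [mem_mix, mem_setBit]
  by_cases hei : e = i
  · subst hei; simp only [hi, and_false, not_false_eq_true, and_true, false_or, true_and, ne_eq, not_true, or_false]
  · simp only [hei, ne_eq, not_false_eq_true, and_true, false_and, false_or]

omit [Fintype ι] in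
/-- For `i ∉ Z`: `mix (Z ∪ {i}) (X ∪ {i}) U = mix Z X (U ∪ {i})`. [folklore] -/
private theorem mix_insert_insert {Z : Set ι} {i : ι} (hi : i ∉ Z) (X U : Set ι) :
    mix (insert i Z) (insert i X) U = mix Z X (insert i U) := by
  ext e
  simp only [mem_mix, Set.mem_insert_iff]
  by_cases hei : e = i
  · subst hei; simp only [true_or, hi, not_true, and_false, or_false, and_true, not_false_eq_true,
      or_true]
  · simp only [hei, false_or]

omit [Fintype ι] in
/-- For `i ∉ Z`: `mix (Z ∪ {i}) (X ∖ {i}) U = mix Z X (U ∖ {i})`. [folklore] -/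
private theorem mix_insert_diff {Z : Set ι} {i : ι} (hi : i ∉ Z) (X U : Set ι) :
    mix (insert i Z) (X \ {i}) U = mix Z X (U \ {i}) := by
  ext e
  simp only [mem_mix, Set.mem_insert_iff, Set.mem_sdiff, Set.mem_singleton_iff]
  by_cases hei : e = i
  · subst hei; simp only [not_true, and_false, false_and, true_or, not_true, or_self, hi, and_true]
  · simp only [hei, not_false_eq_true, and_true, false_or]

/-! ### Cylinder sums `avg`, (AD-cond), (AD-eq) -/

/-- The averaging/restriction operator: `avg Z f U = Σ_X f(mix Z X U)` sums `f` over the coordinates in `Z`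
with the coordinates off `Z` frozen at the pattern `U` (each cylinder point counted `2^{|ι∖Z|}` times, a
harmless uniform factor).  The source's `f(w + z)`, `w ∈ {0,1}ⁿ`, `z ∈ {0,∘}ⁿ`, is `avg {k : z_k = ∘} f w`.
[cite: ChanPak2026, §5.3–5.4 (restriction and averaging operations), §6.1] -/
def avg (Z : Set ι) (f : Set ι → ℝ) (U : Set ι) : ℝ := ∑ X : Set ι, f (mix Z X U)

/-- Averaging all coordinates gives the total sum `f(∘ⁿ) = Σ_x f(x)`. [cite: ChanPak2026, §5.4] -/
theorem avg_univ (f : Set ι → ℝ) (U : Set ι) : avg Set.univ f U = ∑ X, f X := by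
  unfold avg; exact sum_congr rfl fun X _ => by rw [mix_univ]

/-- Averaging no coordinate evaluates (times the uniform factor `#2^ι`). [cite: ChanPak2026, §5.3] -/
theorem avg_empty (f : Set ι → ℝ) (U : Set ι) : avg ∅ f U = (Fintype.card (Set ι) : ℝ) * f U := by
  unfold avg
  rw [sum_congr rfl fun X _ => by rw [mix_empty], sum_const, card_univ, nsmul_eq_mul]

/-- `avg Z f U` depends on the pattern `U` only off `Z`. [cite: ChanPak2026, §6.1] -/
theorem avg_congr {Z U U' : Set ι} (h : ∀ e, e ∉ Z → (e ∈ U ↔ e ∈ U')) (f : Set ι → ℝ) :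
    avg Z f U = avg Z f U' := by
  unfold avg; exact sum_congr rfl fun X _ => by rw [mix_congr h]

/-- `avg` of a nonnegative function is nonnegative. [folklore] -/
private theorem avg_nonneg {f : Set ι → ℝ} (hf : ∀ X, 0 ≤ f X) (Z U : Set ι) : 0 ≤ avg Z f U :=
  sum_nonneg fun _ _ => hf _

/-- **Averaging one more coordinate** (`i ∉ Z`): `f(…,1_i,…) + f(…,0_i,…) = 2·f(…,∘_i,…)` in `avg` form,
`avg Z f (U ∪ {i}) + avg Z f (U ∖ {i}) = 2 · avg (Z ∪ {i}) f U`. [cite: ChanPak2026, §5.4 (averaging operation)] -/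
theorem avg_insert {Z : Set ι} {i : ι} (hi : i ∉ Z) (f : Set ι → ℝ) (U : Set ι) :
    avg Z f (insert i U) + avg Z f (U \ {i}) = 2 * avg (insert i Z) f U := by
  unfold avg
  rw [FKGEquality.two_mul_sum_eq i (fun X => f (mix (insert i Z) X U))]
  congr 1
  · exact sum_congr rfl fun X _ => by rw [mix_insert_insert hi]
  · exact sum_congr rfl fun X _ => by rw [mix_insert_diff hi]

/-- The same with `setBit`. [cite: ChanPak2026, §5.4] -/
theorem avg_setBit_add {Z : Set ι} {i : ι} (hi : i ∉ Z) (f : Set ι → ℝ) (U : Set ι) :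
    avg Z f (setBit U i false) + avg Z f (setBit U i true) = 2 * avg (insert i Z) f U := by
  rw [setBit_true, setBit_false, add_comm, avg_insert hi]

/-- **(AD-cond)** for four nonnegative functions on `2^ι`: `a(x) b(y) ≤ c(x ∨ y) d(x ∧ y)`.
[cite: ChanPak2026, Thm. 1.1 (AD-cond), §5.1] -/
structure IsAD (a b c d : Set ι → ℝ) : Prop where
  /-- `a ≥ 0` -/
  ha : ∀ X, 0 ≤ a X
  /-- `b ≥ 0` -/
  hb : ∀ X, 0 ≤ b X
  /-- `c ≥ 0` -/
  hc : ∀ X, 0 ≤ c X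
  /-- `d ≥ 0` -/
  hd : ∀ X, 0 ≤ d X
  /-- the Ahlswede–Daykin condition -/
  cond : ∀ X Y, a X * b Y ≤ c (X ∪ Y) * d (X ∩ Y)

/-- **(AD-eq)**: equality in the four functions theorem, `Σa · Σb = Σc · Σd`.
[cite: ChanPak2026, Thm. 1.3 (AD-eq), Thm. 5.1 (5.1)] -/
def ADEq (a b c d : Set ι → ℝ) : Prop := (∑ X, a X) * ∑ X, b X = (∑ X, c X) * ∑ X, d X

omit [Fintype ι] in
/-- (AD-cond) is symmetric in `a ↔ b`. [cite: ChanPak2026, §5.1] -/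
theorem IsAD.swap {a b c d : Set ι → ℝ} (hq : IsAD a b c d) : IsAD b a c d where
  ha := hq.hb
  hb := hq.ha
  hc := hq.hc
  hd := hq.hd
  cond X Y := by rw [mul_comm, Set.union_comm, Set.inter_comm]; exact hq.cond Y X

variable {a b c d : Set ι → ℝ}

/-- **The four functions theorem for all derived quadruples at once** (Lemmas 5.3 and 5.4 with the AD
inequality): restricting to patterns `U, V` off `Z` and averaging over `Z`,
`avg Z a U · avg Z b V ≤ avg Z c (U ∪ V) · avg Z d (U ∩ V)`.
[cite: ChanPak2026, Lemma 5.3, Lemma 5.4, Thm. 1.1] [cite: AhlswedeDaykin1978, Thm. 1] -/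
theorem avg_mul_avg_le (hq : IsAD a b c d) (Z U V : Set ι) :
    avg Z a U * avg Z b V ≤ avg Z c (U ∪ V) * avg Z d (U ∩ V) := by
  have h := four_functions_theorem_univ (fun X => a (mix Z X U)) (fun X => b (mix Z X V))
    (fun X => d (mix Z X (U ∩ V))) (fun X => c (mix Z X (U ∪ V))) (fun _ => hq.ha _) (fun _ => hq.hb _)
    (fun _ => hq.hd _) (fun _ => hq.hc _) (fun X Y => ?_)
  · unfold avg; rw [mul_comm (∑ X, c _)]; exact h
  · show a (mix Z X U) * b (mix Z Y V) ≤ d (mix Z (X ∩ Y) (U ∩ V)) * c (mix Z (X ∪ Y) (U ∪ V))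
    rw [mul_comm (d _), ← mix_union_mix, ← mix_inter_mix]
    exact hq.cond _ _

/-- **Lemma 5.2 in context** (the `n = 1` analysis of coordinate `i ∉ Z`, with `Z` averaged and the other
coordinates frozen at the patterns `U` (for `a`), `V` (for `b`), `U ∪ V` (for `c`), `U ∩ V` (for `d`)): if
`a(…∘_i…) b(…∘_i…) = c(…∘_i…) d(…∘_i…)` then (A0): `a(…t_i…) b(…t_i…) = c(…t_i…) d(…t_i…)` for `t = 0, 1`, and
(A1) or (A2) for the two mixed products. [cite: ChanPak2026, Lemma 5.2, Lemmas 5.3–5.4] -/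
theorem collapse (hq : IsAD a b c d) {Z : Set ι} {i : ι} (hi : i ∉ Z) (U V : Set ι)
    (hbal : avg (insert i Z) a U * avg (insert i Z) b V =
      avg (insert i Z) c (U ∪ V) * avg (insert i Z) d (U ∩ V)) :
    (∀ t, avg Z a (setBit U i t) * avg Z b (setBit V i t) =
        avg Z c (setBit (U ∪ V) i t) * avg Z d (setBit (U ∩ V) i t)) ∧
    ((avg Z a (setBit U i false) * avg Z b (setBit V i true) =
          avg Z c (setBit (U ∪ V) i false) * avg Z d (setBit (U ∩ V) i true) ∧
        avg Z a (setBit U i true) * avg Z b (setBit V i false) =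
          avg Z c (setBit (U ∪ V) i true) * avg Z d (setBit (U ∩ V) i false)) ∨
      (avg Z a (setBit U i false) * avg Z b (setBit V i true) =
          avg Z c (setBit (U ∪ V) i true) * avg Z d (setBit (U ∩ V) i false) ∧
        avg Z a (setBit U i true) * avg Z b (setBit V i false) =
          avg Z c (setBit (U ∪ V) i false) * avg Z d (setBit (U ∩ V) i true))) := by
  have hle : ∀ x y, avg Z a (setBit U i x) * avg Z b (setBit V i y) ≤
      avg Z c (setBit (U ∪ V) i (x || y)) * avg Z d (setBit (U ∩ V) i (x && y)) := fun x y => by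
    rw [← setBit_union, ← setBit_inter]; exact avg_mul_avg_le hq Z _ _
  have heq : (avg Z a (setBit U i false) + avg Z a (setBit U i true)) *
      (avg Z b (setBit V i false) + avg Z b (setBit V i true)) =
      (avg Z c (setBit (U ∪ V) i false) + avg Z c (setBit (U ∪ V) i true)) *
      (avg Z d (setBit (U ∩ V) i false) + avg Z d (setBit (U ∩ V) i true)) := by
    rw [avg_setBit_add hi, avg_setBit_add hi, avg_setBit_add hi, avg_setBit_add hi]
    linear_combination 4 * hbal
  have h52 := lemma52 (avg_nonneg hq.ha _ _) (avg_nonneg hq.ha _ _) (avg_nonneg hq.hb _ _)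
    (avg_nonneg hq.hb _ _) (avg_nonneg hq.hc _ _) (avg_nonneg hq.hc _ _) (avg_nonneg hq.hd _ _)
    (avg_nonneg hq.hd _ _) (hle false false) (hle true true) (hle false true) (hle true false) heq
  refine ⟨fun t => ?_, h52.2⟩
  cases t
  · exact h52.1.1
  · exact h52.1.2

/-! ### Types (Definition 7.1) and the diagonal (Lemma 5.5) -/

/-- "`i` has type (B1)": `a(∘,1_i,∘) b(∘,0_i,∘) = c(∘,1_i,∘) d(∘,0_i,∘)` (all other coordinates averaged).
[cite: ChanPak2026, Definition 7.1 (B1)] -/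
def TypeB1 (a b c d : Set ι → ℝ) (i : ι) : Prop :=
  avg {i}ᶜ a Set.univ * avg {i}ᶜ b ∅ = avg {i}ᶜ c Set.univ * avg {i}ᶜ d ∅

/-- "`i` has type (B2)": `a(∘,0_i,∘) b(∘,1_i,∘) = c(∘,1_i,∘) d(∘,0_i,∘)`. [cite: ChanPak2026, Definition 7.1 (B2)] -/
def TypeB2 (a b c d : Set ι → ℝ) (i : ι) : Prop :=
  avg {i}ᶜ a ∅ * avg {i}ᶜ b Set.univ = avg {i}ᶜ c Set.univ * avg {i}ᶜ d ∅

omit [Fintype ι] in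
/-- `insert i {i}ᶜ = univ`. [folklore] -/
private theorem insert_compl_singleton (i : ι) : insert i ({i}ᶜ : Set ι) = Set.univ := by
  ext e; simp only [Set.mem_insert_iff, Set.mem_compl_iff, Set.mem_singleton_iff, Set.mem_univ, iff_true]
  exact em _

/-- With all coordinates but `i` averaged, only the bit at `i` of the pattern matters. [cite: ChanPak2026, §6.1] -/
theorem avg_compl_singleton_congr {i : ι} {U U' : Set ι} (h : i ∈ U ↔ i ∈ U') (f : Set ι → ℝ) :
    avg {i}ᶜ f U = avg {i}ᶜ f U' :=
  avg_congr (fun e he => by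
    simp only [Set.mem_compl_iff, Set.mem_singleton_iff, not_not] at he
    subst he; exact h) f

/-- **Every coordinate has type (B1) or type (B2)** under (AD-cond) and (AD-eq) ("It follows from Lemma 5.2,
that each `i ∈ [n]` must have at least one of these two types"). [cite: ChanPak2026, §7.1 (after Def. 7.1)] -/
theorem hasType (hq : IsAD a b c d) (heq : ADEq a b c d) (i : ι) : TypeB1 a b c d i ∨ TypeB2 a b c d i := by
  have hi : i ∉ ({i}ᶜ : Set ι) := fun h => h rfl
  have hbal : avg (insert i {i}ᶜ) a ∅ * avg (insert i {i}ᶜ) b ∅ =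
      avg (insert i {i}ᶜ) c (∅ ∪ ∅) * avg (insert i {i}ᶜ) d (∅ ∩ ∅) := by
    rw [insert_compl_singleton, avg_univ, avg_univ, avg_univ, avg_univ]; exact heq
  have h := (collapse hq hi ∅ ∅ hbal).2
  have e1 : setBit (∅ : Set ι) i true = {i} := by
    rw [setBit_true]; ext e; simp only [Set.mem_insert_iff, Set.mem_empty_iff_false, or_false,
      Set.mem_singleton_iff]
  have e0 : setBit (∅ : Set ι) i false = ∅ := by rw [setBit_false, Set.empty_sdiff]
  simp only [Set.union_self, Set.inter_self, e1, e0] at h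
  have hu : avg {i}ᶜ a {i} = avg {i}ᶜ a Set.univ :=
    avg_compl_singleton_congr (by simp only [Set.mem_singleton_iff, Set.mem_univ]) a
  have hu' : avg {i}ᶜ b {i} = avg {i}ᶜ b Set.univ :=
    avg_compl_singleton_congr (by simp only [Set.mem_singleton_iff, Set.mem_univ]) b
  have hu'' : avg {i}ᶜ c {i} = avg {i}ᶜ c Set.univ :=
    avg_compl_singleton_congr (by simp only [Set.mem_singleton_iff, Set.mem_univ]) c
  rcases h with hA1 | hA2
  · left
    unfold TypeB1
    rw [← hu, ← hu'']
    exact hA1.2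
  · right
    unfold TypeB2
    rw [← hu', ← hu'']
    exact hA2.1

/-- **Lemma 5.5 in `avg` form**: under (AD-cond) and (AD-eq), for every set `T` of frozen coordinates and every
pattern `U`, `a b = c d` along the diagonal: `avg Tᶜ a U · avg Tᶜ b U = avg Tᶜ c U · avg Tᶜ d U` (induction on
`T`, one application of (A0) per coordinate). [cite: ChanPak2026, Lemma 5.5] -/
theorem diag_avg (hq : IsAD a b c d) (heq : ADEq a b c d) (T : Finset ι) (U : Set ι) :
    avg (↑T)ᶜ a U * avg (↑T)ᶜ b U = avg (↑T)ᶜ c U * avg (↑T)ᶜ d U := by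
  induction T using Finset.induction_on generalizing U with
  | empty =>
    rw [Finset.coe_empty, Set.compl_empty, avg_univ, avg_univ, avg_univ, avg_univ]; exact heq
  | @insert i T hiT ih =>
    have hi : i ∉ ((↑(insert i T) : Set ι)ᶜ) := fun h => h (Finset.mem_coe.2 (Finset.mem_insert_self i T))
    have hZ : insert i ((↑(insert i T) : Set ι)ᶜ) = (↑T : Set ι)ᶜ := by
      ext e
      simp only [Set.mem_insert_iff, Set.mem_compl_iff, Finset.mem_coe, Finset.mem_insert, not_or]
      constructor
      · rintro (rfl | ⟨_, h⟩)
        · exact hiT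
        · exact h
      · intro h
        by_cases hei : e = i
        · exact Or.inl hei
        · exact Or.inr ⟨hei, h⟩
    have hbal : avg (insert i ((↑(insert i T) : Set ι)ᶜ)) a U * avg (insert i ((↑(insert i T) : Set ι)ᶜ)) b U =
        avg (insert i ((↑(insert i T) : Set ι)ᶜ)) c (U ∪ U) *
          avg (insert i ((↑(insert i T) : Set ι)ᶜ)) d (U ∩ U) := by
      rw [hZ, Set.union_self, Set.inter_self]; exact ih U
    have h := (collapse hq hi U U hbal).1 (decide (i ∈ U))
    rw [Set.union_self, Set.inter_self] at h
    have hU : setBit U i (decide (i ∈ U)) = U := by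
      by_cases hiU : i ∈ U
      · rw [decide_eq_true hiU, setBit_of_mem hiU]
      · rw [decide_eq_false hiU, setBit_of_not_mem hiU]
    rwa [hU] at h

/-- **Lemma 5.5**: under (AD-cond) and (AD-eq), `a(x) b(x) = c(x) d(x)` for every `x`.
[cite: ChanPak2026, Lemma 5.5] -/
theorem diag (hq : IsAD a b c d) (heq : ADEq a b c d) (X : Set ι) : a X * b X = c X * d X := by
  have h := diag_avg hq heq Finset.univ X
  rw [Finset.coe_univ, Set.compl_univ, avg_empty, avg_empty, avg_empty, avg_empty] at h
  have hN : (0 : ℝ) < Fintype.card (Set ι) := by exact_mod_cast Fintype.card_pos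
  have h' : ((Fintype.card (Set ι) : ℝ) * Fintype.card (Set ι)) * (a X * b X) =
      ((Fintype.card (Set ι) : ℝ) * Fintype.card (Set ι)) * (c X * d X) := by linear_combination h
  exact mul_left_cancel₀ (mul_pos hN hN).ne' h'

/-! ### The two-coordinate context: instantiating Part A -/

/-- The `{0,1}²`-quadruple seen in two coordinates `i, j ∉ Z` (`Z` averaged, the rest frozen at the pattern
`W`): `(x, y) ↦ avg Z f (W with i := x, j := y)`. [cite: ChanPak2026, §7.3 (the functions a″, b″, c″, d″)] -/
def q2 (Z : Set ι) (f : Set ι → ℝ) (W : Set ι) (i j : ι) (x y : Bool) : ℝ :=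
  avg Z f (setBit (setBit W i x) j y)

/-- Unfolding `q2`. [cite: ChanPak2026, §7.3] -/
theorem q2_apply (Z : Set ι) (f : Set ι → ℝ) (W : Set ι) (i j : ι) (x y : Bool) :
    q2 Z f W i j x y = avg Z f (setBit (setBit W i x) j y) := rfl

/-- The two-coordinate context satisfies (AD-cond) on `{0,1}²` (Lemmas 5.3–5.4).
[cite: ChanPak2026, Lemma 5.3, Lemma 5.4] -/
theorem ad2_ctx (hq : IsAD a b c d) (Z U V : Set ι) (i j : ι) :
    AD2 (q2 Z a U i j) (q2 Z b V i j) (q2 Z c (U ∪ V) i j) (q2 Z d (U ∩ V) i j) where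
  ha _ _ := avg_nonneg hq.ha _ _
  hb _ _ := avg_nonneg hq.hb _ _
  hc _ _ := avg_nonneg hq.hc _ _
  hd _ _ := avg_nonneg hq.hd _ _
  cond x y x' y' := by
    simp only [q2_apply]
    rw [← setBit_union, ← setBit_union, ← setBit_inter, ← setBit_inter]
    exact avg_mul_avg_le hq Z _ _

/-- Row sums of the context quadruple: `a(x, ∘) = 2·avg (Z ∪ {j}) a (W with i := x)`. [cite: ChanPak2026, §5.4] -/
theorem row_q2 {Z : Set ι} {j : ι} (hj : j ∉ Z) (f : Set ι → ℝ) (W : Set ι) (i : ι) (x : Bool) :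
    row (q2 Z f W i j) x = 2 * avg (insert j Z) f (setBit W i x) := by
  rw [row, q2_apply, q2_apply, avg_setBit_add hj]

/-- Column sums of the context quadruple: `a(∘, y) = 2·avg (Z ∪ {i}) a (W with j := y)`.
[cite: ChanPak2026, §5.4] -/
theorem col_q2 {Z : Set ι} {i j : ι} (hi : i ∉ Z) (hij : i ≠ j) (f : Set ι → ℝ) (W : Set ι) (y : Bool) :
    col (q2 Z f W i j) y = 2 * avg (insert i Z) f (setBit W j y) := by
  rw [col, q2_apply, q2_apply, setBit_comm hij, setBit_comm hij, avg_setBit_add hi]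

/-- Total sum of the context quadruple: `a(∘, ∘) = 4·avg (Z ∪ {i,j}) a W`. [cite: ChanPak2026, §5.4] -/
theorem tot_q2 {Z : Set ι} {i j : ι} (hi : i ∉ Z) (hj : j ∉ Z) (hij : i ≠ j) (f : Set ι → ℝ) (W : Set ι) :
    tot (q2 Z f W i j) = 4 * avg (insert i (insert j Z)) f W := by
  have hi' : i ∉ insert j Z := fun h => by
    rcases Set.mem_insert_iff.1 h with h | h
    · exact hij h
    · exact hi h
  rw [tot, row_q2 hj, row_q2 hj, ← mul_add, avg_setBit_add hi']
  ring

/-! ### The Identification Lemma 7.2 -/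

omit [Fintype ι] in
/-- Pattern bookkeeping for `A ∋ i`. [folklore] -/
private theorem setBit_A_true {A : Set ι} {i : ι} (h : i ∈ A) : setBit A i true = A := setBit_of_mem h

omit [Fintype ι] in
/-- Pattern bookkeeping for `A ∋ i`. [folklore] -/
private theorem setBit_Ac_false {A : Set ι} {i : ι} (h : i ∈ A) : setBit Aᶜ i false = Aᶜ :=
  setBit_of_not_mem (fun h' => h' h)

omit [Fintype ι] in
/-- Pattern bookkeeping for `A ∌ i`. [folklore] -/
private theorem setBit_A_false {A : Set ι} {i : ι} (h : i ∉ A) : setBit A i false = A := setBit_of_not_mem h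

omit [Fintype ι] in
/-- Pattern bookkeeping for `A ∌ i`. [folklore] -/
private theorem setBit_Ac_true {A : Set ι} {i : ι} (h : i ∉ A) : setBit Aᶜ i true = Aᶜ := setBit_of_mem h

omit [Fintype ι] in
/-- Pattern bookkeeping: `univ` with a bit set to `1`. [folklore] -/
private theorem setBit_univ_true (i : ι) : setBit (Set.univ : Set ι) i true = Set.univ :=
  setBit_of_mem (Set.mem_univ i)

omit [Fintype ι] in
/-- Pattern bookkeeping: `∅` with a bit set to `0`. [folklore] -/
private theorem setBit_empty_false (i : ι) : setBit (∅ : Set ι) i false = ∅ :=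
  setBit_of_not_mem (Set.notMem_empty i)

omit [Fintype ι] in
/-- `(↑(T.erase j))ᶜ = insert j (↑T)ᶜ` for `j ∈ T`. [folklore] -/
private theorem compl_coe_erase {T : Finset ι} {j : ι} (hj : j ∈ T) :
    ((↑(T.erase j) : Set ι))ᶜ = insert j ((↑T : Set ι)ᶜ) := by
  ext e
  simp only [Set.mem_compl_iff, Finset.mem_coe, Finset.mem_erase, not_and, Set.mem_insert_iff]
  constructor
  · intro h
    by_cases hej : e = j
    · exact Or.inl hej
    · exact Or.inr (h hej)
  · rintro (rfl | h)
    · exact fun h => (h rfl).elim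
    · exact fun _ => h

/-- The hypothesis (6.1) of the Consistency Lemma / conclusion (7.2) of the Identification Lemma at the averaged
set `Z`: `a(1_A 0_{Aᶜ} + z) b(0_A 1_{Aᶜ} + z) = c(1ⁿ + z) d(0ⁿ + z)`, `z = ∘` exactly on `Z`.
[cite: ChanPak2026, Lemma 6.1 (6.1), Lemma 7.2 (7.2)] -/
def HypH (a b c d : Set ι → ℝ) (A Z : Set ι) : Prop :=
  avg Z a A * avg Z b Aᶜ = avg Z c Set.univ * avg Z d ∅

/-- **Identification Lemma 7.2.**  Under (AD-cond) and (AD-eq), with `A := {i : i has type (B1)}` (the source's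
`x`, `x_i = 1` iff `i` is of type (B1); `y = 1 + x` is `Aᶜ`), the identity (7.2)
`a(x + z) b(y + z) = c(1ⁿ + z) d(0ⁿ + z)` holds for every `z ∈ {0,∘}ⁿ` — here: `HypH a b c d A (↑T)ᶜ` for every
finite set `T` of non-averaged coordinates.  Proof as printed, by induction on `|T|`: `|T| ≤ 1` is the
definition of the types; `|T| = 2` is Lemma 7.4 (equal types) or Lemma 7.5 (different types, by contradiction);
`|T| ≥ 3` picks two coordinates of equal type (pigeonhole) and applies Lemma 7.4 to the two-coordinate context,
whose hypotheses are the induction hypothesis at `T` minus one or two points (the source reaches the averaged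
cases through its induction on `n`; with `avg` this is the same recursion). [cite: ChanPak2026, Lemma 7.2] -/
theorem lemma72 (hq : IsAD a b c d) (heq : ADEq a b c d) {A : Set ι} (hA : ∀ i, i ∈ A ↔ TypeB1 a b c d i)
    (T : Finset ι) : HypH a b c d A (↑T)ᶜ := by
  induction' hn : T.card using Nat.strong_induction_on with n ih generalizing T
  -- types of the coordinates
  have hB1 : ∀ {i}, i ∈ A → TypeB1 a b c d i := fun h => (hA _).1 h
  have hB2 : ∀ {i}, i ∉ A → TypeB2 a b c d i := fun {i} h =>
    (hasType hq heq i).resolve_left fun h' => h ((hA i).2 h')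
  unfold HypH
  rcases Nat.lt_or_ge n 3 with hn3 | hn3
  · interval_cases n
    · -- `T = ∅`: (AD-eq)
      rw [Finset.card_eq_zero] at hn; subst hn
      rw [Finset.coe_empty, Set.compl_empty, avg_univ, avg_univ, avg_univ, avg_univ]; exact heq
    · -- `T = {i}`: the type of `i`
      obtain ⟨i, rfl⟩ := Finset.card_eq_one.1 hn
      rw [Finset.coe_singleton]
      by_cases hiA : i ∈ A
      · have h := hB1 hiA
        unfold TypeB1 at h
        rwa [avg_compl_singleton_congr (U := Set.univ) (U' := A) (by simp [hiA]),
          avg_compl_singleton_congr (U := ∅) (U' := Aᶜ) (by simp [hiA])] at h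
      · have h := hB2 hiA
        unfold TypeB2 at h
        rwa [avg_compl_singleton_congr (U := ∅) (U' := A) (by simp [hiA]),
          avg_compl_singleton_congr (U := Set.univ) (U' := Aᶜ) (by simp [hiA])] at h
    · -- `T = {i, j}`: Lemmas 7.4 / 7.5
      obtain ⟨i, j, hij, rfl⟩ := Finset.card_eq_two.1 hn
      -- orient so that, in the mixed case, the first coordinate is in `A`
      suffices key : ∀ i j : ι, i ≠ j → (i ∈ A ∨ j ∉ A) →
          avg (↑({i, j} : Finset ι))ᶜ a A * avg (↑({i, j} : Finset ι))ᶜ b Aᶜ =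
            avg (↑({i, j} : Finset ι))ᶜ c Set.univ * avg (↑({i, j} : Finset ι))ᶜ d ∅ by
        by_cases h : i ∈ A ∨ j ∉ A
        · exact key i j hij h
        · push Not at h
          rw [Finset.pair_comm]
          exact key j i hij.symm (Or.inl h.2)
      intro i j hij hor
      set Z : Set ι := (↑({i, j} : Finset ι))ᶜ with hZ
      have hiZ : i ∉ Z := fun h => h (by simp)
      have hjZ : j ∉ Z := fun h => h (by simp)
      have hZj : insert j Z = {i}ᶜ := by
        ext e; simp only [hZ, Set.mem_insert_iff, Set.mem_compl_iff, Finset.coe_insert, Finset.coe_singleton,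
          Set.mem_singleton_iff, not_or]; constructor
        · rintro (rfl | ⟨h1, _⟩); exacts [hij.symm, h1]
        · intro h; by_cases hej : e = j; exacts [Or.inl hej, Or.inr ⟨h, hej⟩]
      have hZi : insert i Z = {j}ᶜ := by
        ext e; simp only [hZ, Set.mem_insert_iff, Set.mem_compl_iff, Finset.coe_insert, Finset.coe_singleton,
          Set.mem_singleton_iff, not_or]; constructor
        · rintro (rfl | ⟨_, h2⟩); exacts [hij, h2]
        · intro h; by_cases hei : e = i; exacts [Or.inl hei, Or.inr ⟨hei, h⟩]
      have hZij : insert i (insert j Z) = Set.univ := by rw [hZj, insert_compl_singleton]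
      -- the two-coordinate context with patterns `A`, `Aᶜ`
      have h2 := ad2_ctx hq Z A Aᶜ i j
      rw [Set.union_compl_self, Set.inter_compl_self] at h2
      have hEq2 : Eq2 (q2 Z a A i j) (q2 Z b Aᶜ i j) (q2 Z c Set.univ i j) (q2 Z d ∅ i j) := by
        unfold Eq2
        rw [tot_q2 hiZ hjZ hij, tot_q2 hiZ hjZ hij, tot_q2 hiZ hjZ hij, tot_q2 hiZ hjZ hij, hZij, avg_univ,
          avg_univ, avg_univ, avg_univ]
        unfold ADEq at heq
        linear_combination 16 * heq
      -- types of `i` and `j` seen in the context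
      have hB1i : i ∈ A → B1fst (q2 Z a A i j) (q2 Z b Aᶜ i j) (q2 Z c Set.univ i j) (q2 Z d ∅ i j) := by
        intro hiA; unfold B1fst
        rw [row_q2 hjZ, row_q2 hjZ, row_q2 hjZ, row_q2 hjZ, setBit_A_true hiA, setBit_Ac_false hiA,
          setBit_univ_true, setBit_empty_false, hZj]
        have h := hB1 hiA; unfold TypeB1 at h
        rw [avg_compl_singleton_congr (U := Set.univ) (U' := A) (by simp [hiA]),
          avg_compl_singleton_congr (U := ∅) (U' := Aᶜ) (by simp [hiA])] at h
        linear_combination 4 * h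
      have hB2i : i ∉ A → B2fst (q2 Z a A i j) (q2 Z b Aᶜ i j) (q2 Z c Set.univ i j) (q2 Z d ∅ i j) := by
        intro hiA; unfold B2fst
        rw [row_q2 hjZ, row_q2 hjZ, row_q2 hjZ, row_q2 hjZ, setBit_A_false hiA, setBit_Ac_true hiA,
          setBit_univ_true, setBit_empty_false, hZj]
        have h := hB2 hiA; unfold TypeB2 at h
        rw [avg_compl_singleton_congr (U := ∅) (U' := A) (by simp [hiA]),
          avg_compl_singleton_congr (U := Set.univ) (U' := Aᶜ) (by simp [hiA])] at h
        linear_combination 4 * h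
      have hB1j : j ∈ A → B1snd (q2 Z a A i j) (q2 Z b Aᶜ i j) (q2 Z c Set.univ i j) (q2 Z d ∅ i j) := by
        intro hjA; unfold B1snd
        rw [col_q2 hiZ hij, col_q2 hiZ hij, col_q2 hiZ hij, col_q2 hiZ hij, setBit_A_true hjA,
          setBit_Ac_false hjA, setBit_univ_true, setBit_empty_false, hZi]
        have h := hB1 hjA; unfold TypeB1 at h
        rw [avg_compl_singleton_congr (U := Set.univ) (U' := A) (by simp [hjA]),
          avg_compl_singleton_congr (U := ∅) (U' := Aᶜ) (by simp [hjA])] at h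
        linear_combination 4 * h
      have hB2j : j ∉ A → B2snd (q2 Z a A i j) (q2 Z b Aᶜ i j) (q2 Z c Set.univ i j) (q2 Z d ∅ i j) := by
        intro hjA; unfold B2snd
        rw [col_q2 hiZ hij, col_q2 hiZ hij, col_q2 hiZ hij, col_q2 hiZ hij, setBit_A_false hjA,
          setBit_Ac_true hjA, setBit_univ_true, setBit_empty_false, hZi]
        have h := hB2 hjA; unfold TypeB2 at h
        rw [avg_compl_singleton_congr (U := ∅) (U' := A) (by simp [hjA]),
          avg_compl_singleton_congr (U := Set.univ) (U' := Aᶜ) (by simp [hjA])] at h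
        linear_combination 4 * h
      by_cases hiA : i ∈ A
      · by_cases hjA : j ∈ A
        · -- both of type (B1): Lemma 7.4
          have h := lemma74 h2 hEq2 (hB1i hiA) (hB1j hjA)
          simp only [q2_apply, setBit_A_true hiA, setBit_Ac_false hiA, setBit_univ_true, setBit_empty_false,
            setBit_A_true hjA, setBit_Ac_false hjA] at h
          exact h
        · -- `i` of type (B1), `j` not: Lemma 7.5 by contradiction
          by_contra hne
          have h78 : q2 Z a A i j true false * q2 Z b Aᶜ i j false true ≠
              q2 Z c Set.univ i j true true * q2 Z d ∅ i j false false := by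
            simp only [q2_apply, setBit_A_true hiA, setBit_Ac_false hiA, setBit_univ_true, setBit_empty_false,
              setBit_A_false hjA, setBit_Ac_true hjA]
            exact hne
          have h := (lemma75 h2 hEq2 (hB1i hiA) (hB2j hjA) h78).2
          -- `j` would have type (B1)
          refine hjA ((hA j).2 ?_)
          unfold B1snd at h
          rw [col_q2 hiZ hij, col_q2 hiZ hij, col_q2 hiZ hij, col_q2 hiZ hij, hZi] at h
          unfold TypeB1
          rw [avg_compl_singleton_congr (U := Set.univ) (U' := setBit A j true) (by simp),
            avg_compl_singleton_congr (U := ∅) (U' := setBit Aᶜ j false) (by simp),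
            ← setBit_univ_true j, ← setBit_empty_false j]
          linear_combination h / 4
      · have hjA : j ∉ A := hor.resolve_left hiA
        -- both of type (B2): Lemma 7.4 with `a ↔ b`
        have h := lemma74' h2 hEq2 (hB2i hiA) (hB2j hjA)
        simp only [q2_apply, setBit_A_false hiA, setBit_Ac_true hiA, setBit_univ_true, setBit_empty_false,
          setBit_A_false hjA, setBit_Ac_true hjA] at h
        exact h
  · -- `|T| ≥ 3`: two coordinates of `T` with the same type (pigeonhole), then Lemma 7.4
    obtain ⟨i, hi, j, hj, hij, hsame⟩ : ∃ i ∈ T, ∃ j ∈ T, i ≠ j ∧ (i ∈ A ↔ j ∈ A) := by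
      have hcard : 2 < T.card := by omega
      obtain ⟨k₁, hk₁, k₂, hk₂, k₃, hk₃, h12, h13, h23⟩ := Finset.two_lt_card.1 hcard
      by_cases h1 : k₁ ∈ A
      · by_cases h2 : k₂ ∈ A
        · exact ⟨k₁, hk₁, k₂, hk₂, h12, by simp [h1, h2]⟩
        · by_cases h3 : k₃ ∈ A
          · exact ⟨k₁, hk₁, k₃, hk₃, h13, by simp [h1, h3]⟩
          · exact ⟨k₂, hk₂, k₃, hk₃, h23, by simp [h2, h3]⟩
      · by_cases h2 : k₂ ∈ A
        · by_cases h3 : k₃ ∈ A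
          · exact ⟨k₂, hk₂, k₃, hk₃, h23, by simp [h2, h3]⟩
          · exact ⟨k₁, hk₁, k₃, hk₃, h13, by simp [h1, h3]⟩
        · exact ⟨k₁, hk₁, k₂, hk₂, h12, by simp [h1, h2]⟩
    set Z : Set ι := (↑T : Set ι)ᶜ with hZ
    have hiZ : i ∉ Z := fun h => h (Finset.mem_coe.2 hi)
    have hjZ : j ∉ Z := fun h => h (Finset.mem_coe.2 hj)
    -- induction hypotheses at `T ∖ {j}`, `T ∖ {i}`, `T ∖ {i, j}`
    have hTj : HypH a b c d A (insert j Z) := by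
      rw [hZ, ← compl_coe_erase hj]
      exact ih _ (by rw [Finset.card_erase_of_mem hj]; omega) _ rfl
    have hTi : HypH a b c d A (insert i Z) := by
      rw [hZ, ← compl_coe_erase hi]
      exact ih _ (by rw [Finset.card_erase_of_mem hi]; omega) _ rfl
    have hTij : HypH a b c d A (insert i (insert j Z)) := by
      have hi' : i ∈ T.erase j := Finset.mem_erase.2 ⟨hij, hi⟩
      rw [hZ, ← compl_coe_erase hj, ← compl_coe_erase hi']
      exact ih _ (by rw [Finset.card_erase_of_mem hi', Finset.card_erase_of_mem hj]; omega) _ rfl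
    unfold HypH at hTj hTi hTij
    have h2 := ad2_ctx hq Z A Aᶜ i j
    rw [Set.union_compl_self, Set.inter_compl_self] at h2
    have hEq2 : Eq2 (q2 Z a A i j) (q2 Z b Aᶜ i j) (q2 Z c Set.univ i j) (q2 Z d ∅ i j) := by
      unfold Eq2
      rw [tot_q2 hiZ hjZ hij, tot_q2 hiZ hjZ hij, tot_q2 hiZ hjZ hij, tot_q2 hiZ hjZ hij]
      linear_combination 16 * hTij
    by_cases hiA : i ∈ A
    · have hjA : j ∈ A := hsame.1 hiA
      have hB1i : B1fst (q2 Z a A i j) (q2 Z b Aᶜ i j) (q2 Z c Set.univ i j) (q2 Z d ∅ i j) := by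
        unfold B1fst
        rw [row_q2 hjZ, row_q2 hjZ, row_q2 hjZ, row_q2 hjZ, setBit_A_true hiA, setBit_Ac_false hiA,
          setBit_univ_true, setBit_empty_false]
        linear_combination 4 * hTj
      have hB1j : B1snd (q2 Z a A i j) (q2 Z b Aᶜ i j) (q2 Z c Set.univ i j) (q2 Z d ∅ i j) := by
        unfold B1snd
        rw [col_q2 hiZ hij, col_q2 hiZ hij, col_q2 hiZ hij, col_q2 hiZ hij, setBit_A_true hjA,
          setBit_Ac_false hjA, setBit_univ_true, setBit_empty_false]
        linear_combination 4 * hTi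
      have h := lemma74 h2 hEq2 hB1i hB1j
      simp only [q2_apply, setBit_A_true hiA, setBit_Ac_false hiA, setBit_univ_true, setBit_empty_false,
        setBit_A_true hjA, setBit_Ac_false hjA] at h
      exact h
    · have hjA : j ∉ A := fun h => hiA (hsame.2 h)
      have hB2i : B2fst (q2 Z a A i j) (q2 Z b Aᶜ i j) (q2 Z c Set.univ i j) (q2 Z d ∅ i j) := by
        unfold B2fst
        rw [row_q2 hjZ, row_q2 hjZ, row_q2 hjZ, row_q2 hjZ, setBit_A_false hiA, setBit_Ac_true hiA,
          setBit_univ_true, setBit_empty_false]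
        linear_combination 4 * hTj
      have hB2j : B2snd (q2 Z a A i j) (q2 Z b Aᶜ i j) (q2 Z c Set.univ i j) (q2 Z d ∅ i j) := by
        unfold B2snd
        rw [col_q2 hiZ hij, col_q2 hiZ hij, col_q2 hiZ hij, col_q2 hiZ hij, setBit_A_false hjA,
          setBit_Ac_true hjA, setBit_univ_true, setBit_empty_false]
        linear_combination 4 * hTi
      have h := lemma74' h2 hEq2 hB2i hB2j
      simp only [q2_apply, setBit_A_false hiA, setBit_Ac_true hiA, setBit_univ_true, setBit_empty_false,
        setBit_A_false hjA, setBit_Ac_true hjA] at h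
      exact h

/-! ### The Consistency Lemma 6.1 -/

/-- The restriction of `f` at coordinate `i` to the bit `t`: `f(∗, t_i, ∗)` as a function on all of `2^ι`
(ignoring the bit at `i`). [cite: ChanPak2026, §5.3 (restriction operation)] -/
def res (i : ι) (t : Bool) (f : Set ι → ℝ) : Set ι → ℝ := fun X => f (setBit X i t)

omit [Fintype ι] in
/-- Unfolding `res`. [cite: ChanPak2026, §5.3] -/
theorem res_apply (i : ι) (t : Bool) (f : Set ι → ℝ) (X : Set ι) : res i t f X = f (setBit X i t) := rfl

omit [Fintype ι] in
/-- **Lemma 5.3**: the restricted quadruple `a(x_i,·), b(y_i,·), c((x∨y)_i,·), d((x∧y)_i,·)` satisfies (AD-cond).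
[cite: ChanPak2026, Lemma 5.3] -/
theorem IsAD.res (hq : IsAD a b c d) (i : ι) (x y : Bool) :
    IsAD (res i x a) (res i y b) (res i (x || y) c) (res i (x && y) d) where
  ha _ := hq.ha _
  hb _ := hq.hb _
  hc _ := hq.hc _
  hd _ := hq.hd _
  cond X Y := by
    simp only [res_apply]
    rw [← setBit_union, ← setBit_inter]
    exact hq.cond _ _

/-- Averaging a restricted function = averaging with the restricted pattern (`i ∉ Z`). [cite: ChanPak2026, §5.3–5.4] -/
theorem avg_res {Z : Set ι} {i : ι} (hi : i ∉ Z) (t : Bool) (f : Set ι → ℝ) (U : Set ι) :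
    avg Z (res i t f) U = avg Z f (setBit U i t) := by
  unfold avg; exact sum_congr rfl fun X _ => by rw [res_apply, mix_setBit hi]

omit [Fintype ι] in
/-- With every coordinate but `i` averaged, the pattern is read only at `i`. [folklore] -/
private theorem mix_compl_singleton_setBit (i : ι) (X U : Set ι) (t : Bool) :
    mix {i}ᶜ X (setBit U i t) = setBit X i t := by
  ext e
  simp only [mem_mix, mem_setBit, Set.mem_compl_iff, Set.mem_singleton_iff, not_not]
  by_cases hei : e = i
  · subst hei; simp only [not_true, and_false, false_or, true_and, and_true, ne_eq, or_false]
  · simp only [hei, not_false_eq_true, and_true, and_false, or_false, ne_eq, false_and, false_or]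

/-- The total sum of a restricted function: `Σ_x f(t_i, x) = avg {i}ᶜ f (t at i)`. [cite: ChanPak2026, §5.4] -/
theorem sum_res (i : ι) (t : Bool) (f : Set ι → ℝ) : ∑ X, res i t f X = avg {i}ᶜ f (setBit ∅ i t) := by
  unfold avg; exact sum_congr rfl fun X _ => by rw [res_apply, mix_compl_singleton_setBit]

omit [Fintype ι] in
/-- A restricted function no longer depends on the restricted coordinate. [cite: ChanPak2026, §5.3] -/
theorem detBy_res {f : Set ι → ℝ} {S : Set ι} (hf : DetBy f S) (i : ι) (t : Bool) :
    DetBy (res i t f) (S \ {i}) := by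
  intro ω
  simp only [res_apply]
  rw [hf (setBit ω i t), hf (setBit (ω ∩ (S \ {i})) i t)]
  congr 1
  ext e
  simp only [Set.mem_inter_iff, mem_setBit, Set.mem_sdiff, Set.mem_singleton_iff]
  tauto

omit [Fintype ι] in
/-- The bit of `X` at `i` set to its own value. [folklore] -/
private theorem setBit_decide_mem (X : Set ι) (i : ι) : setBit X i (decide (i ∈ X)) = X := by
  by_cases h : i ∈ X
  · rw [decide_eq_true h, setBit_of_mem h]
  · rw [decide_eq_false h, setBit_of_not_mem h]

/-- **A dead coordinate can be dropped from the averaged set**: if `f` does not depend on the coordinate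
`i ∉ S`, then `avg Z f U = avg (Z ∖ {i}) f U` (averaging a restricted function over the restricted coordinate is
harmless). [cite: ChanPak2026, §5.3–5.4 (restriction and averaging operations)] -/
theorem avg_sdiff_singleton_of_detBy {f : Set ι → ℝ} {S : Set ι} (hf : DetBy f S) {i : ι} (hi : i ∉ S)
    (Z U : Set ι) : avg Z f U = avg (Z \ {i}) f U := by
  unfold avg
  refine sum_congr rfl fun X _ => ?_
  rw [hf (mix Z X U), hf (mix (Z \ {i}) X U)]
  congr 1
  ext e
  simp only [Set.mem_inter_iff, mem_mix, Set.mem_sdiff, Set.mem_singleton_iff, not_and, not_not]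
  by_cases hei : e = i
  · subst hei; simp only [hi, and_false]
  · tauto

/-- The cross relation (5.2) for the coordinate set `A`: writing `x = (x₁, x₂)` along `A ⊔ Aᶜ`,
`a(x₁,x₂) b(y₁,y₂) = c(x₁,y₂) d(y₁,x₂)` for all `x, y` — here `mix A X Y` is `(x₁, y₂)` and `mix A Y X` is
`(y₁, x₂)`. [cite: ChanPak2026, Thm. 5.1 (5.2), Lemma 6.1 (6.2)] -/
def CrossEq (A : Set ι) (a b c d : Set ι → ℝ) : Prop := ∀ X Y, a X * b Y = c (mix A X Y) * d (mix A Y X)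

/-- Coordinate `i` is "bad" for the pair `(X, Y)`: the only position pattern NOT covered by Cases 1–2 of the
printed proof of Lemma 6.1 — `i ∈ A` with `(x_i, y_i) = (0,1)`, or `i ∉ A` with `(x_i, y_i) = (1,0)`.
[cite: ChanPak2026, §6.2 (Cases 1, 2 and the remaining pair)] -/
def Bad (A X Y : Set ι) (i : ι) : Prop := (i ∈ A ∧ i ∉ X ∧ i ∈ Y) ∨ (i ∉ A ∧ i ∈ X ∧ i ∉ Y)

/-- **Cases 1–2 of Lemma 6.1 at a good coordinate `i ∉ Z`**: the hypothesis (6.1) passes to the quadruple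
restricted at `i` to the bits `(x_i, y_i, x_i ∨ y_i, x_i ∧ y_i)` — via (A0) of Lemma 5.2 when `x_i = y_i`
(Case 1), verbatim when `(x_i, y_i)` is the good mixed pattern (Case 2). [cite: ChanPak2026, §6.2 (Cases 1–2)] -/
theorem hypH_res_of_not_bad (hq : IsAD a b c d) {A : Set ι} (hH : ∀ Z, HypH a b c d A Z) {X Y : Set ι} {i : ι}
    (hnb : ¬ Bad A X Y i) {Z : Set ι} (hi : i ∉ Z) :
    avg Z a (setBit A i (decide (i ∈ X))) * avg Z b (setBit Aᶜ i (decide (i ∈ Y))) =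
      avg Z c (setBit Set.univ i (decide (i ∈ X) || decide (i ∈ Y))) *
        avg Z d (setBit ∅ i (decide (i ∈ X) && decide (i ∈ Y))) := by
  have hbal : avg (insert i Z) a A * avg (insert i Z) b Aᶜ =
      avg (insert i Z) c (A ∪ Aᶜ) * avg (insert i Z) d (A ∩ Aᶜ) := by
    rw [Set.union_compl_self, Set.inter_compl_self]; exact hH _
  have hA0 := (collapse hq hi A Aᶜ hbal).1
  simp only [Set.union_compl_self, Set.inter_compl_self] at hA0
  unfold Bad at hnb
  by_cases hX : i ∈ X <;> by_cases hY : i ∈ Y <;>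
    simp only [hX, hY, decide_true, decide_false, Bool.or_self, Bool.and_self, Bool.true_or, Bool.or_true,
      Bool.and_false, Bool.false_and]
  · -- Case 1 with `x_i = y_i = 1`
    exact hA0 true
  · -- Case 2: `(1,0)`, so `i ∈ A`
    have hiA : i ∈ A := by by_contra h; exact hnb (Or.inr ⟨h, hX, hY⟩)
    rw [setBit_A_true hiA, setBit_Ac_false hiA, setBit_univ_true, setBit_empty_false]; exact hH Z
  · -- Case 2: `(0,1)`, so `i ∉ A`
    have hiA : i ∉ A := fun h => hnb (Or.inl ⟨h, hX, hY⟩)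
    rw [setBit_A_false hiA, setBit_Ac_true hiA, setBit_univ_true, setBit_empty_false]; exact hH Z
  · -- Case 1 with `x_i = y_i = 0`
    exact hA0 false

omit [Fintype ι] in
/-- At a good coordinate the mixed configurations already carry the bits `x_i ∨ y_i`, `x_i ∧ y_i`. [folklore] -/
private theorem setBit_mix_of_not_bad {A X Y : Set ι} {i : ι} (hnb : ¬ Bad A X Y i) :
    setBit (mix A X Y) i (decide (i ∈ X) || decide (i ∈ Y)) = mix A X Y ∧
      setBit (mix A Y X) i (decide (i ∈ X) && decide (i ∈ Y)) = mix A Y X := by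
  unfold Bad at hnb
  have hm1 : i ∈ mix A X Y ↔ (i ∈ X ∧ i ∈ A) ∨ (i ∈ Y ∧ i ∉ A) := mem_mix
  have hm2 : i ∈ mix A Y X ↔ (i ∈ Y ∧ i ∈ A) ∨ (i ∈ X ∧ i ∉ A) := mem_mix
  by_cases hX : i ∈ X <;> by_cases hY : i ∈ Y <;>
    simp only [hX, hY, decide_true, decide_false, Bool.or_self, Bool.and_self, Bool.true_or, Bool.or_true,
      Bool.and_false, Bool.false_and]
  · exact ⟨setBit_of_mem (hm1.2 (by tauto)), setBit_of_mem (hm2.2 (by tauto))⟩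
  · have hiA : i ∈ A := by by_contra h; exact hnb (Or.inr ⟨h, hX, hY⟩)
    exact ⟨setBit_of_mem (hm1.2 (Or.inl ⟨hX, hiA⟩)), setBit_of_not_mem (fun h => by
      rcases hm2.1 h with h | h
      · exact hY h.1
      · exact h.2 hiA)⟩
  · have hiA : i ∉ A := fun h => hnb (Or.inl ⟨h, hX, hY⟩)
    exact ⟨setBit_of_mem (hm1.2 (Or.inr ⟨hY, hiA⟩)), setBit_of_not_mem (fun h => by
      rcases hm2.1 h with h | h
      · exact hiA h.2
      · exact hX h.1)⟩
  · exact ⟨setBit_of_not_mem (fun h => by rcases hm1.1 h with h | h; exacts [hX h.1, hY h.1]),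
      setBit_of_not_mem (fun h => by rcases hm2.1 h with h | h; exacts [hY h.1, hX h.1])⟩

/-- The sum of the cross differences vanishes under (AD-eq): `Σ_{x,y} [a(x)b(y) − c(x₁,y₂)d(y₁,x₂)] = 0`
("the sum of (6.2) over all pairs equals (AD-eq)", via the involution `(x,y) ↦ ((x₁,y₂),(y₁,x₂))`).
[cite: ChanPak2026, §6.2 (last paragraph)] -/
theorem sum_cross_sub_eq_zero (heq : ADEq a b c d) (A : Set ι) :
    ∑ X, ∑ Y, (a X * b Y - c (mix A X Y) * d (mix A Y X)) = 0 := by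
  have h1 : ∑ X, ∑ Y, a X * b Y = (∑ X, a X) * ∑ X, b X := by rw [sum_mul_sum]
  have h2 : ∑ X, ∑ Y, c (mix A X Y) * d (mix A Y X) = (∑ X, c X) * ∑ X, d X := by
    rw [sum_mul_sum, ← Fintype.sum_prod_type', ← Fintype.sum_prod_type']
    exact Equiv.sum_comp (mixEquiv A) (fun p : Set ι × Set ι => c p.1 * d p.2)
  simp only [sum_sub_distrib]
  rw [h1, h2, heq, sub_self]

/-- **Consistency Lemma 6.1.**  For four nonnegative functions on `2^ι` satisfying (AD-cond) and (AD-eq) and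
depending only on the coordinates in `s`, the hypothesis (6.1) — `a(1_A0_{Aᶜ} + z) b(0_A1_{Aᶜ} + z) =
c(1ⁿ + z) d(0ⁿ + z)` for all `z ∈ {0,∘}ⁿ` — implies (6.2): `a(x₁,x₂) b(y₁,y₂) = c(x₁,y₂) d(y₁,x₂)` for all
`x, y`.  Proof as printed, by induction on the number of live coordinates: a pair `(x, y)` with a good live
coordinate `i` (Case 1: `x_i = y_i`; Case 2: the mixed pattern matching `A`) is reduced to the quadruple
restricted at `i` (Lemmas 5.3, 5.2 (A0) supply its hypotheses); the remaining pairs — bad at every live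
coordinate — are handled by summing (6.2) over all pairs, which is (AD-eq). [cite: ChanPak2026, Lemma 6.1] -/
theorem lemma61 (A : Set ι) : ∀ (n : ℕ) (s : Finset ι), s.card = n → ∀ (a b c d : Set ι → ℝ),
    DetBy a ↑s → DetBy b ↑s → DetBy c ↑s → DetBy d ↑s → IsAD a b c d → ADEq a b c d →
    (∀ Z, HypH a b c d A Z) → CrossEq A a b c d := by
  intro n
  induction' n using Nat.strong_induction_on with n ih
  intro s hs a b c d hda hdb hdc hdd hq heq hH
  -- Cases 1–2: pairs with a good live coordinate
  have hgood : ∀ X Y : Set ι, (∃ i ∈ s, ¬ Bad A X Y i) → a X * b Y = c (mix A X Y) * d (mix A Y X) := by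
    intro X Y ⟨i, his, hnb⟩
    set x : Bool := decide (i ∈ X) with hx
    set y : Bool := decide (i ∈ Y) with hy
    -- the quadruple restricted at `i`
    have hq' := hq.res i x y
    have hs' : (↑(s.erase i) : Set ι) = ↑s \ {i} := Finset.coe_erase i s
    have hda' : DetBy (res i x a) ↑(s.erase i) := by rw [hs']; exact detBy_res hda i x
    have hdb' : DetBy (res i y b) ↑(s.erase i) := by rw [hs']; exact detBy_res hdb i y
    have hdc' : DetBy (res i (x || y) c) ↑(s.erase i) := by rw [hs']; exact detBy_res hdc i _
    have hdd' : DetBy (res i (x && y) d) ↑(s.erase i) := by rw [hs']; exact detBy_res hdd i _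
    have hic : i ∉ ({i}ᶜ : Set ι) := fun h => h rfl
    have heq' : ADEq (res i x a) (res i y b) (res i (x || y) c) (res i (x && y) d) := by
      unfold ADEq
      rw [sum_res, sum_res, sum_res, sum_res]
      have h := hypH_res_of_not_bad hq hH hnb hic
      rw [avg_compl_singleton_congr (U := setBit A i x) (U' := setBit ∅ i x)
          (by simp only [mem_setBit, true_and, ne_eq, not_true, and_false, or_false]),
        avg_compl_singleton_congr (U := setBit Aᶜ i y) (U' := setBit ∅ i y)
          (by simp only [mem_setBit, true_and, ne_eq, not_true, and_false, or_false]),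
        avg_compl_singleton_congr (U := setBit Set.univ i (x || y)) (U' := setBit ∅ i (x || y))
          (by simp only [mem_setBit, true_and, ne_eq, not_true, and_false, or_false])] at h
      exact h
    have hH' : ∀ Z, HypH (res i x a) (res i y b) (res i (x || y) c) (res i (x && y) d) A Z := by
      intro Z
      unfold HypH
      have hi' : i ∉ (↑s : Set ι) \ {i} := fun h => h.2 rfl
      rw [avg_sdiff_singleton_of_detBy (detBy_res hda i x) hi' Z A,
        avg_sdiff_singleton_of_detBy (detBy_res hdb i y) hi' Z Aᶜ,
        avg_sdiff_singleton_of_detBy (detBy_res hdc i (x || y)) hi' Z Set.univ,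
        avg_sdiff_singleton_of_detBy (detBy_res hdd i (x && y)) hi' Z ∅]
      have hiZ : i ∉ Z \ {i} := fun h => h.2 rfl
      rw [avg_res hiZ, avg_res hiZ, avg_res hiZ, avg_res hiZ]
      exact hypH_res_of_not_bad hq hH hnb hiZ
    have hcard : (s.erase i).card < n := by
      have h0 : 0 < s.card := Finset.card_pos.2 ⟨i, his⟩
      rw [Finset.card_erase_of_mem his]; omega
    have hce := ih _ hcard (s.erase i) rfl _ _ _ _ hda' hdb' hdc' hdd' hq' heq' hH' X Y
    simp only [res_apply] at hce
    obtain ⟨hm1, hm2⟩ := setBit_mix_of_not_bad hnb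
    rwa [hx, hy, setBit_decide_mem, setBit_decide_mem, hm1, hm2] at hce
  -- the remaining pairs: bad at every live coordinate
  intro X Y
  by_cases hex : ∃ i ∈ s, ¬ Bad A X Y i
  · exact hgood X Y hex
  push Not at hex
  -- the common value `τ` of the cross difference on all-bad pairs
  set τ : ℝ := a (↑s \ A) * b (↑s ∩ A) - c ∅ * d ↑s with hτ
  have hval : ∀ X' Y' : Set ι, (∀ i ∈ s, Bad A X' Y' i) →
      a X' * b Y' - c (mix A X' Y') * d (mix A Y' X') = τ := by
    intro X' Y' hbad
    have e1 : X' ∩ ↑s = ↑s \ A := by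
      ext e; simp only [Set.mem_inter_iff, Finset.mem_coe, Set.mem_sdiff]
      constructor
      · rintro ⟨heX, hes⟩
        refine ⟨hes, fun heA => ?_⟩
        rcases hbad e hes with h | h
        · exact h.2.1 heX
        · exact h.1 heA
      · rintro ⟨hes, heA⟩
        rcases hbad e hes with h | h
        · exact absurd h.1 heA
        · exact ⟨h.2.1, hes⟩
    have e2 : Y' ∩ ↑s = ↑s ∩ A := by
      ext e; simp only [Set.mem_inter_iff, Finset.mem_coe]
      constructor
      · rintro ⟨heY, hes⟩
        refine ⟨hes, ?_⟩
        rcases hbad e hes with h | h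
        · exact h.1
        · exact absurd heY h.2.2
      · rintro ⟨hes, heA⟩
        rcases hbad e hes with h | h
        · exact ⟨h.2.2, hes⟩
        · exact absurd heA h.1
    have e3 : mix A X' Y' ∩ ↑s = ∅ ∩ ↑s := by
      ext e; simp only [Set.mem_inter_iff, mem_mix, Finset.mem_coe, Set.mem_empty_iff_false, false_and,
        iff_false, not_and]
      rintro (h | h) hes
      · rcases hbad e hes with h' | h'
        · exact h'.2.1 h.1
        · exact h'.1 h.2
      · rcases hbad e hes with h' | h'
        · exact h.2 h'.1
        · exact h'.2.2 h.1
    have e4 : mix A Y' X' ∩ ↑s = ↑s ∩ ↑s := by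
      ext e; simp only [Set.mem_inter_iff, mem_mix, Finset.mem_coe, and_self]
      constructor
      · exact fun h => h.2
      · intro hes
        refine ⟨?_, hes⟩
        rcases hbad e hes with h | h
        · exact Or.inl ⟨h.2.2, h.1⟩
        · exact Or.inr ⟨h.2.1, h.1⟩
    rw [hda X', hdb Y', hdc (mix A X' Y'), hdd (mix A Y' X'), e1, e2, e3, e4, ← hdc ∅, ← hdd ↑s]
  have hzero : ∀ X' Y' : Set ι, ¬ (∀ i ∈ s, Bad A X' Y' i) →
      a X' * b Y' - c (mix A X' Y') * d (mix A Y' X') = 0 := by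
    intro X' Y' h
    push Not at h
    rw [hgood X' Y' h, sub_self]
  -- summing over all pairs: `0 = τ · #{all-bad pairs}` with the pair `(X, Y)` among them
  have hsum := sum_cross_sub_eq_zero heq A
  have hite : ∀ X' Y' : Set ι, a X' * b Y' - c (mix A X' Y') * d (mix A Y' X') =
      τ * (if (∀ i ∈ s, Bad A X' Y' i) then 1 else 0) := by
    intro X' Y'
    split_ifs with h
    · rw [mul_one]; exact hval X' Y' h
    · rw [mul_zero]; exact hzero X' Y' h
  simp_rw [hite, ← mul_sum] at hsum
  have hK : (0 : ℝ) < ∑ X', ∑ Y', (if (∀ i ∈ s, Bad A X' Y' i) then (1 : ℝ) else 0) := by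
    have h1 : (1 : ℝ) ≤ ∑ Y', (if (∀ i ∈ s, Bad A X Y' i) then (1 : ℝ) else 0) := by
      have := single_le_sum (f := fun Y' => if (∀ i ∈ s, Bad A X Y' i) then (1 : ℝ) else 0)
        (fun Y' _ => by positivity) (mem_univ Y)
      simpa only [if_pos hex] using this
    have h2 : ∑ Y', (if (∀ i ∈ s, Bad A X Y' i) then (1 : ℝ) else 0) ≤
        ∑ X', ∑ Y', (if (∀ i ∈ s, Bad A X' Y' i) then (1 : ℝ) else 0) :=
      single_le_sum (f := fun X' => ∑ Y', if (∀ i ∈ s, Bad A X' Y' i) then (1 : ℝ) else 0)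
        (fun X' _ => sum_nonneg fun Y' _ => by positivity) (mem_univ X)
    linarith
  have hτ0 : τ = 0 := by
    rcases mul_eq_zero.1 hsum with h | h
    · exact h
    · exact absurd h hK.ne'
  have h := hval X Y hex
  rw [hτ0, sub_eq_zero] at h
  exact h

/-! ### Theorem 5.1 -/

/-- **Theorem 5.1, `⇒`.**  Under (AD-cond), equality (AD-eq) forces the cross relation (5.2) for
`A := {i : i has type (B1)}` (§7.4: the Identification Lemma 7.2 supplies the hypothesis (6.1) of the
Consistency Lemma 6.1). [cite: ChanPak2026, Thm. 5.1, §7.4] -/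
theorem crossEq_of_adEq (hq : IsAD a b c d) (heq : ADEq a b c d) :
    CrossEq {i | TypeB1 a b c d i} a b c d := by
  have hH : ∀ Z, HypH a b c d {i | TypeB1 a b c d i} Z := by
    intro Z
    have h := lemma72 hq heq (A := {i | TypeB1 a b c d i}) (fun i => Iff.rfl) Zᶜ.toFinset
    rwa [Set.coe_toFinset, compl_compl] at h
  exact lemma61 _ _ Finset.univ rfl a b c d (by rw [Finset.coe_univ]; exact DetBy.univ a)
    (by rw [Finset.coe_univ]; exact DetBy.univ b) (by rw [Finset.coe_univ]; exact DetBy.univ c)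
    (by rw [Finset.coe_univ]; exact DetBy.univ d) hq heq hH

/-- **Theorem 5.1, `⇐`** ("the `⇐` direction is clear"): the cross relation (5.2) for some `A` gives (AD-eq), by
summing over all pairs along the involution `(x, y) ↦ ((x₁,y₂), (y₁,x₂))` (no (AD-cond) needed).
[cite: ChanPak2026, Thm. 5.1] -/
theorem adEq_of_crossEq {A : Set ι} (h : CrossEq A a b c d) : ADEq a b c d := by
  unfold ADEq
  rw [sum_mul_sum, sum_mul_sum, ← Fintype.sum_prod_type', ← Fintype.sum_prod_type',
    ← Equiv.sum_comp (mixEquiv A) (fun p : Set ι × Set ι => c p.1 * d p.2)]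
  exact Fintype.sum_congr _ _ fun p => h p.1 p.2

/-- **Theorem 5.1 (AD equality for Boolean lattices).**  Let `a, b, c, d : 2^ι → ℝ≥0` satisfy (AD-cond).  Then
the AD equality `Σa · Σb = Σc · Σd` (5.1) holds if and only if there is a subset `A ⊆ ι` such that
`a(x₁,x₂) b(y₁,y₂) = c(x₁,y₂) d(y₁,x₂)` for all `(x₁,x₂), (y₁,y₂) ∈ {0,1}^A × {0,1}^{ι∖A}` (5.2).
[cite: ChanPak2026, Thm. 5.1] -/
theorem chanPak_thm51 (hq : IsAD a b c d) : ADEq a b c d ↔ ∃ A : Set ι, CrossEq A a b c d :=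
  ⟨fun heq => ⟨_, crossEq_of_adEq hq heq⟩, fun ⟨_, h⟩ => adEq_of_crossEq h⟩

/-! ### Theorem 8.1: the cross-factoring version -/

omit [Fintype ι] in
/-- `mix A X P` on `A`, then re-mixed on `A`: the inner off-`A` part is discarded. [folklore] -/
private theorem mix_mix_left (A X P Q : Set ι) : mix A (mix A X P) Q = mix A X Q := by
  ext e; simp only [mem_mix]; tauto

omit [Fintype ι] in
/-- Re-mixing in the second argument discards the inner `A`-part. [folklore] -/
private theorem mix_mix_right (A P Q X : Set ι) : mix A P (mix A Q X) = mix A P X := by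
  ext e; simp only [mem_mix]; tauto

omit [Fintype ι] in
/-- `mix A X X = X`. [folklore] -/
private theorem mix_self' (A X : Set ι) : mix A X X = X := by
  ext e; simp only [mem_mix]; tauto

omit [Fintype ι] in
/-- A function determined by `A` reads only the `A`-part of a mixed configuration. [folklore] -/
private theorem apply_mix_left_of_detBy {f : Set ι → ℝ} {A : Set ι} (hf : DetBy f A) (X Y : Set ι) :
    f (mix A X Y) = f X := by
  rw [hf (mix A X Y), hf X]; congr 1; ext e; simp only [Set.mem_inter_iff, mem_mix]; tauto

omit [Fintype ι] in
/-- A function determined by `Aᶜ` reads only the off-`A` part of a mixed configuration. [folklore] -/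
private theorem apply_mix_right_of_detBy {f : Set ι → ℝ} {A : Set ι} (hf : DetBy f Aᶜ) (X Y : Set ι) :
    f (mix A X Y) = f Y := by
  rw [hf (mix A X Y), hf Y]; congr 1; ext e; simp only [Set.mem_inter_iff, mem_mix, Set.mem_compl_iff]; tauto

/-- **Cross-factoring along `A`** (Definition 1.2 read on the Boolean lattice `2^ι ≃ 2^A × 2^{ι∖A}`): there are
nonnegative `f₁, g₁` depending only on the coordinates in `A`, `f₂, g₂` depending only on those off `A`, and
constants `α, β, γ, δ ≥ 0` with `αβ = γδ`, such that `a = α f₁ f₂`, `b = β g₁ g₂`, `c = γ f₁ g₂`, `d = δ g₁ f₂` (8.1).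
[cite: ChanPak2026, Definition 1.2, Theorem 8.1 (8.1)] -/
def CrossFactor (A : Set ι) (a b c d : Set ι → ℝ) : Prop :=
  ∃ (f₁ g₁ f₂ g₂ : Set ι → ℝ) (α β γ δ : ℝ), (∀ X, 0 ≤ f₁ X) ∧ (∀ X, 0 ≤ g₁ X) ∧ (∀ X, 0 ≤ f₂ X) ∧
    (∀ X, 0 ≤ g₂ X) ∧ DetBy f₁ A ∧ DetBy g₁ A ∧ DetBy f₂ Aᶜ ∧ DetBy g₂ Aᶜ ∧
    0 ≤ α ∧ 0 ≤ β ∧ 0 ≤ γ ∧ 0 ≤ δ ∧ α * β = γ * δ ∧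
    ∀ X, a X = α * f₁ X * f₂ X ∧ b X = β * g₁ X * g₂ X ∧ c X = γ * f₁ X * g₂ X ∧ d X = δ * g₁ X * f₂ X

omit [Fintype ι] in
/-- Cross-factoring along `A` implies the cross relation (5.2) along `A` ("when four functions cross-factor on
`L`, we have an equality in (AD)"; pointwise form). [cite: ChanPak2026, §1.2 (after Def. 1.2), Thm. 8.1] -/
theorem crossEq_of_crossFactor {A : Set ι} (h : CrossFactor A a b c d) : CrossEq A a b c d := by
  obtain ⟨f₁, g₁, f₂, g₂, α, β, γ, δ, -, -, -, -, hf₁, hg₁, hf₂, hg₂, -, -, -, -, hαβ, hX⟩ := h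
  intro X Y
  rw [(hX X).1, (hX Y).2.1, (hX (mix A X Y)).2.2.1, (hX (mix A Y X)).2.2.2, apply_mix_left_of_detBy hf₁,
    apply_mix_right_of_detBy hg₂, apply_mix_left_of_detBy hg₁, apply_mix_right_of_detBy hf₂]
  linear_combination (f₁ X * f₂ X * g₁ Y * g₂ Y) * hαβ

omit [Fintype ι] in
/-- **Theorem 8.1, non-degenerate case** (the printed proof): if `a, b, c, d ≥ 0` satisfy the cross relation (5.2)
along `A` and neither `a` nor `b` vanishes identically, then `a, b, c, d` cross-factor along the SAME `A`, with
`f₁(x₁) = a(x₁,u₂)`, `g₁(x₁) = b(x₁,v₂)`, `f₂(x₂) = a(u₁,x₂)`, `g₂(x₂) = b(v₁,x₂)` for any `u, v` with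
`a(u), b(v) > 0` (the source rescales to `a(u) = b(v) = c(u₁,v₂) = d(v₁,u₂) = 1`; here the constants are kept:
`γ = 1/d(v₁,u₂)`, `δ = 1/c(u₁,v₂)`, `α = b(v)/(c(u₁,v₂)d(v₁,u₂))`, `β = a(u)/(c(u₁,v₂)d(v₁,u₂))`).  Only
nonnegativity and (5.2) are used. [cite: ChanPak2026, Theorem 8.1 (proof)] -/
theorem crossFactor_of_crossEq (ha : ∀ X, 0 ≤ a X) (hb : ∀ X, 0 ≤ b X) (hc : ∀ X, 0 ≤ c X) (hd : ∀ X, 0 ≤ d X)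
    {A : Set ι} (h : CrossEq A a b c d) (hau : ∃ u, a u ≠ 0) (hbv : ∃ v, b v ≠ 0) : CrossFactor A a b c d := by
  obtain ⟨u, hu⟩ := hau
  obtain ⟨v, hv⟩ := hbv
  have hp : 0 < a u := lt_of_le_of_ne (ha u) (Ne.symm hu)
  have hq : 0 < b v := lt_of_le_of_ne (hb v) (Ne.symm hv)
  -- `γ₀ := c(u₁,v₂)`, `δ₀ := d(v₁,u₂)`, with `a(u) b(v) = γ₀ δ₀ > 0`
  have hκ : a u * b v = c (mix A u v) * d (mix A v u) := h u v
  have hγδ : 0 < c (mix A u v) * d (mix A v u) := by rw [← hκ]; exact mul_pos hp hq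
  have hγ₀ : 0 < c (mix A u v) := (pos_pos_of_mul_pos hγδ (hc _) (hd _)).1
  have hδ₀ : 0 < d (mix A v u) := (pos_pos_of_mul_pos hγδ (hc _) (hd _)).2
  -- the four factors and constants
  refine ⟨fun X => a (mix A X u), fun X => b (mix A X v), fun X => a (mix A u X), fun X => b (mix A v X),
    b v / (c (mix A u v) * d (mix A v u)), a u / (c (mix A u v) * d (mix A v u)),
    1 / d (mix A v u), 1 / c (mix A u v),
    fun X => ha _, fun X => hb _, fun X => ha _, fun X => hb _, fun X => ?_, fun X => ?_, fun X => ?_,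
    fun X => ?_, by positivity, by positivity, by positivity, by positivity, ?_, fun X => ?_⟩
  · show a (mix A X u) = a (mix A (X ∩ A) u)
    congr 1; ext e; simp only [mem_mix, Set.mem_inter_iff]; tauto
  · show b (mix A X v) = b (mix A (X ∩ A) v)
    congr 1; ext e; simp only [mem_mix, Set.mem_inter_iff]; tauto
  · show a (mix A u X) = a (mix A u (X ∩ Aᶜ))
    congr 1; ext e; simp only [mem_mix, Set.mem_inter_iff, Set.mem_compl_iff]; tauto
  · show b (mix A v X) = b (mix A v (X ∩ Aᶜ))
    congr 1; ext e; simp only [mem_mix, Set.mem_inter_iff, Set.mem_compl_iff]; tauto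
  · -- `αβ = γδ`
    rw [div_mul_div_comm, div_mul_div_comm, one_mul, div_eq_div_iff (by positivity) (by positivity)]
    linear_combination (c (mix A u v) * d (mix A v u)) * hκ
  · -- the four factorisations, from (5.2) at suitable pairs
    have hcX : a (mix A X u) * b (mix A v X) = c X * d (mix A v u) := by
      have := h (mix A X u) (mix A v X)
      rwa [mix_mix_left, mix_mix_right, mix_self', mix_mix_left, mix_mix_right] at this
    have hdX : a (mix A u X) * b (mix A X v) = c (mix A u v) * d X := by
      have := h (mix A u X) (mix A X v)
      rwa [mix_mix_left, mix_mix_right, mix_mix_left, mix_mix_right, mix_self'] at this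
    have haX : a X * b v = c (mix A X v) * d (mix A v X) := h X v
    have hbX : a u * b X = c (mix A u X) * d (mix A X u) := h u X
    have hcXv : c (mix A X v) * d (mix A v u) = a (mix A X u) * b v := by
      have := h (mix A X u) v
      rw [mix_mix_left, mix_mix_right] at this
      exact this.symm
    have hdvX : c (mix A u v) * d (mix A v X) = a (mix A u X) * b v := by
      have := h (mix A u X) v
      rw [mix_mix_left, mix_mix_right] at this
      exact this.symm
    have hcuX : c (mix A u X) * d (mix A v u) = a u * b (mix A v X) := by
      have := h u (mix A v X)
      rw [mix_mix_right, mix_mix_left] at this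
      exact this.symm
    have hdXu : c (mix A u v) * d (mix A X u) = a u * b (mix A X v) := by
      have := h u (mix A X v)
      rw [mix_mix_right, mix_mix_left] at this
      exact this.symm
    refine ⟨?_, ?_, ?_, ?_⟩
    · -- `a = α f₁ f₂`
      have key : b v * (a X * (c (mix A u v) * d (mix A v u))) =
          b v * (b v * (a (mix A X u) * a (mix A u X))) := by
        calc b v * (a X * (c (mix A u v) * d (mix A v u)))
            = (c (mix A X v) * d (mix A v u)) * (c (mix A u v) * d (mix A v X)) := by
              linear_combination (c (mix A u v) * d (mix A v u)) * haX
          _ = (a (mix A X u) * b v) * (a (mix A u X) * b v) := by rw [hcXv, hdvX]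
          _ = b v * (b v * (a (mix A X u) * a (mix A u X))) := by ring
      have h2 := mul_left_cancel₀ hq.ne' key
      rw [show b v / (c (mix A u v) * d (mix A v u)) * a (mix A X u) * a (mix A u X) =
        b v * (a (mix A X u) * a (mix A u X)) / (c (mix A u v) * d (mix A v u)) by ring]
      exact (eq_div_iff hγδ.ne').2 h2
    · -- `b = β g₁ g₂`
      have key : a u * (b X * (c (mix A u v) * d (mix A v u))) =
          a u * (a u * (b (mix A X v) * b (mix A v X))) := by
        calc a u * (b X * (c (mix A u v) * d (mix A v u)))
            = (c (mix A u X) * d (mix A v u)) * (c (mix A u v) * d (mix A X u)) := by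
              linear_combination (c (mix A u v) * d (mix A v u)) * hbX
          _ = (a u * b (mix A v X)) * (a u * b (mix A X v)) := by rw [hcuX, hdXu]
          _ = a u * (a u * (b (mix A X v) * b (mix A v X))) := by ring
      have h2 := mul_left_cancel₀ hp.ne' key
      rw [show a u / (c (mix A u v) * d (mix A v u)) * b (mix A X v) * b (mix A v X) =
        a u * (b (mix A X v) * b (mix A v X)) / (c (mix A u v) * d (mix A v u)) by ring]
      exact (eq_div_iff hγδ.ne').2 h2
    · -- `c = γ f₁ g₂`
      rw [show 1 / d (mix A v u) * a (mix A X u) * b (mix A v X) =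
        a (mix A X u) * b (mix A v X) / d (mix A v u) by ring]
      exact (eq_div_iff hδ₀.ne').2 (by linear_combination hcX.symm)
    · -- `d = δ g₁ f₂`
      rw [show 1 / c (mix A u v) * b (mix A X v) * a (mix A u X) =
        a (mix A u X) * b (mix A X v) / c (mix A u v) by ring]
      exact (eq_div_iff hγ₀.ne').2 (by linear_combination hdX.symm)

/-- If `a ≡ 0` then the cross relation forces `c ≡ 0` or `d ≡ 0` (and symmetrically for `b`).
[cite: ChanPak2026, §8.1 ("one of the functions c, d is identically 0")] -/
theorem c_or_d_eq_zero_of_crossEq {A : Set ι} (h : CrossEq A a b c d) (h0 : (∀ X, a X = 0) ∨ ∀ X, b X = 0) :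
    (∀ X, c X = 0) ∨ ∀ X, d X = 0 := by
  by_contra hne
  push Not at hne
  obtain ⟨⟨U, hU⟩, ⟨V, hV⟩⟩ := hne
  have e := h (mix A U V) (mix A V U)
  rw [mix_mix_left, mix_mix_right, mix_self', mix_mix_left, mix_mix_right, mix_self'] at e
  have : a (mix A U V) * b (mix A V U) = 0 := by
    rcases h0 with h0 | h0
    · rw [h0, zero_mul]
    · rw [h0, mul_zero]
  rw [this] at e
  rcases mul_eq_zero.1 e.symm with h' | h'
  · exact hU h'
  · exact hV h'

/-- **Theorem 8.1 (cross-factoring version of Theorem 5.1).**  If `a, b, c, d ≥ 0` satisfy the cross relation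
(5.2) along some `A`, then they cross-factor along some `A′` (Definition 1.2 on `2^ι`); one may take `A′ = A`
unless `a` or `b` vanishes identically, in which case (as in the printed proof, "if `a = c = 0`, we can set
`A = ∅`, …") `A′ ∈ {∅, ι}`.  REMARK (scope): the printed formulation "let `A ⊆ [n]` be a subset satisfying
(5.2); then there exist `f₁, g₁ : {0,1}^A → ℝ≥0`, …" must be read with this proviso — for `a ≡ c ≡ 0` and `b` not
of product form along the given `A`, (5.2) holds trivially but (8.1) along that `A` fails; the printed proof
itself switches to `A = ∅` there. [cite: ChanPak2026, Theorem 8.1] -/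
theorem chanPak_thm81 (ha : ∀ X, 0 ≤ a X) (hb : ∀ X, 0 ≤ b X) (hc : ∀ X, 0 ≤ c X) (hd : ∀ X, 0 ≤ d X)
    {A : Set ι} (h : CrossEq A a b c d) : ∃ A' : Set ι, CrossFactor A' a b c d := by
  by_cases hab : (∃ u, a u ≠ 0) ∧ ∃ v, b v ≠ 0
  · exact ⟨A, crossFactor_of_crossEq ha hb hc hd h hab.1 hab.2⟩
  · have h0 : (∀ X, a X = 0) ∨ ∀ X, b X = 0 := by
      by_contra h'
      push Not at h'
      exact hab ⟨h'.1, h'.2⟩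
    have hcd := c_or_d_eq_zero_of_crossEq h h0
    have hconst : ∀ r : ℝ, DetBy (fun _ : Set ι => r) ∅ := fun r ω => rfl
    have hconst' : ∀ r : ℝ, DetBy (fun _ : Set ι => r) (Set.univ : Set ι)ᶜ := fun r ω => rfl
    have hunivc : ∀ f : Set ι → ℝ, DetBy f (∅ : Set ι)ᶜ := fun f => by rw [Set.compl_empty]; exact DetBy.univ f
    rcases h0 with ha0 | hb0 <;> rcases hcd with hc0 | hd0
    · -- `a = c = 0`: `A′ = ∅`, `f₁ = g₁ = 1`, `f₂ = d`, `g₂ = b`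
      refine ⟨∅, fun _ => 1, fun _ => 1, d, b, 0, 1, 0, 1, fun _ => zero_le_one, fun _ => zero_le_one, hd, hb,
        hconst 1, hconst 1, hunivc d, hunivc b, le_rfl, zero_le_one, le_rfl, zero_le_one, by ring, fun X => ?_⟩
      simp only [ha0, hc0, zero_mul, one_mul, true_and]
    · -- `a = d = 0`: `A′ = ι`, `f₁ = c`, `g₁ = b`, `f₂ = g₂ = 1`
      refine ⟨Set.univ, c, b, fun _ => 1, fun _ => 1, 0, 1, 1, 0, hc, hb, fun _ => zero_le_one,
        fun _ => zero_le_one, DetBy.univ c, DetBy.univ b, hconst' 1, hconst' 1, le_rfl, zero_le_one, zero_le_one,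
        le_rfl, by ring, fun X => ?_⟩
      simp only [ha0, hd0, zero_mul, one_mul, mul_one, true_and]
    · -- `b = c = 0`: `A′ = ι`, `f₁ = a`, `g₁ = d`, `f₂ = g₂ = 1`
      refine ⟨Set.univ, a, d, fun _ => 1, fun _ => 1, 1, 0, 0, 1, ha, hd, fun _ => zero_le_one,
        fun _ => zero_le_one, DetBy.univ a, DetBy.univ d, hconst' 1, hconst' 1, zero_le_one, le_rfl, le_rfl,
        zero_le_one, by ring, fun X => ?_⟩
      simp only [hb0, hc0, zero_mul, one_mul, mul_one, true_and]
    · -- `b = d = 0`: `A′ = ∅`, `f₁ = g₁ = 1`, `f₂ = a`, `g₂ = c`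
      refine ⟨∅, fun _ => 1, fun _ => 1, a, c, 1, 0, 1, 0, fun _ => zero_le_one, fun _ => zero_le_one, ha, hc,
        hconst 1, hconst 1, hunivc a, hunivc c, zero_le_one, le_rfl, zero_le_one, le_rfl, by ring, fun X => ?_⟩
      simp only [hb0, hd0, zero_mul, one_mul, true_and]

/-- **Theorems 5.1 + 8.1 together**: under (AD-cond), `Σa · Σb = Σc · Σd` if and only if `a, b, c, d` cross-factor
along some `A ⊆ ι` (Definition 1.2 on the Boolean lattice). [cite: ChanPak2026, Thm. 5.1, Thm. 8.1, Def. 1.2] -/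
theorem adEq_iff_exists_crossFactor (hq : IsAD a b c d) : ADEq a b c d ↔ ∃ A : Set ι, CrossFactor A a b c d := by
  constructor
  · intro heq
    exact chanPak_thm81 hq.ha hq.hb hq.hc hq.hd (crossEq_of_adEq hq heq)
  · rintro ⟨A, hA⟩
    exact adEq_of_crossEq (crossEq_of_crossFactor hA)

end Boolean

end Literature.Probability.LatticeModels.FourFunctionsEquality

end
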